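import Literature.NumberTheory.Sieve.QuadraticRootsTothRays
import HarnessLib

/-!
# Tóth's theorem from Pitt's bound (T. Ngo's Theorem 2.5) for the complete column sums

Topic `Literature/NumberTheory/Sieve`, continuation of `QuadraticRootsTothRays.lean`; the last
file of the descent of Tóth's theorem `toth2000_quadraticRoots_primeModuli`
(`PolynomialCongruencesPrimeModuli.lean`) along the printed lines (Tóth 2000 via T. Ngo,
arXiv:2107.13301): `…TothReduction` (`HP ⇒` the theorem), `…TothColumnSum` (`HD ⇒ HP`),
`…TothDualZero`, `…TothRays` and this file (`HK ⇒ HD`), where `HK` is the bound of Ngo's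
Theorem 2.5 ("essentially due to Pitt": Kuznetsov's trace formula, the spectral large sieve on
`Γ₀(q)` and the exceptional spectrum, after Deshouillers–Iwaniec) for the explicit complete sums
`S_α(h, κ) = colExpSum a d R h α κ` of the columns.  Part 1 constructs the weights of the dyadic
pieces and verifies the hypotheses of Theorem 2.5 for them (Ngo's Lemma 3.17), Part 2 bounds a
piece and decomposes the dual sum, Part 3 does the arithmetic of Ngo's Proposition 3.18 and
concludes with **`toth2000_quadraticRoots_primeModuli_of_pittBound : HK → toth2000_quadraticRoots_primeModuli`**.
All statements are theorems; no named fact is introduced.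

## Part 1. The dyadic pieces of the dual Tóth sums: weights of Theorem-2.5 shape

Continuation of Part 3 of `QuadraticRootsTothRays.lean`.  For a
fixed ray parameter `s` and dyadic indices `k, ℓ` the weight fed into T. Ngo's Theorem 2.5
(arXiv:2107.13301, Pitt's bound) in the proof of his Proposition 3.18 is, in the first-column
conventions of this tree, the PRODUCT

  `V_s(u, κ) = C⁻¹ · f_s(u) · g_s(κ)`,  `f_s(u) = σ_k(λu) · u · colFn(u, us)`,
  `g_s(κ) = ρ_ℓ(κ) · e(cκ)`  (`c = −s/(ad)`),

(`σ_k = dyadic k`, rescaled by `λ > 0` so that `C = K_k/λ`; `ρ_ℓ = dyadic ℓ`, `K_k = dyScale k`):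
see `fourier_colFn_eq_ray`.  This file
verifies the hypotheses of Theorem 2.5 for `V_s` with constants that do NOT depend on
`s, k, ℓ, x, Y₁, d, h`:

* `rayWeight` (`f_s`): smooth on `ℝ` (`contDiff_rayWeight`), and for `C ≤ u ≤ 2C`
  `‖f_s⁽ᴵ⁾(u)‖ ≤ C · A_f(I) · (Y₁/C)ᴵ` (`norm_iteratedDeriv_rayWeight_le`; Ngo's Lemma 3.17 in
  the modulus variable, from `exists_norm_iteratedDeriv_colFn_ray_le` and two Leibniz steps), while
  `f_s ≡ 0` near every `u ∉ [C, 2C]`;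
* `freqWeight` (`g_s`): `‖g_s⁽ᴶ⁾(κ)‖ ≤ A_g(J) (Y/K_ℓ)ᴶ` as soon as `Y ≥ 1` and `2π|c|K_ℓ ≤ Y`
  (`norm_iteratedDeriv_freqWeight_le`);
* `pieceWeight` (`V_s`): smooth on `ℝ²`, supported in `(C, 2C) × (K_ℓ, 2K_ℓ)`, and
  `‖∂_uᴵ ∂_κᴶ V_s‖ ≤ A_f(I) A_g(J) · Y^{I+J}/(Cᴵ K_ℓᴶ)` (`norm_iteratedDeriv_pieceWeight_le`) — the
  hypothesis of Theorem 2.5 with the constant family `A(I, J) = A_f(I) A_g(J)`.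

## References

* T. Ngo, *On roots of quadratic congruences*, arXiv:2107.13301 (Bull. LMS 2024), §2.2 Theorem 2.5,
  §3.5 Lemma 3.17, Proposition 3.18, §3.6 Lemmas 3.20–3.22.
  [cite: Ngo2024, §3.5 Lemma 3.17, Proposition 3.18]
* Á. Tóth, *Roots of quadratic congruences*, IMRN 2000, 719–739. [cite: Toth2000, §4]
-/

noncomputable section

namespace Literature.NumberTheory.Sieve

open scoped MatrixGroups ContDiff FourierTransform ComplexConjugate
open Literature.NumberTheory.QuadraticFields.Quadratic (BinQF)
open Real Finset MeasureTheory

namespace RootForms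

/-! ### Chosen constants -/

/-- A bound `≥ 1` for `‖β_ℂ⁽ⁱ⁾‖`, `i ≤ n` (chosen). [folklore] -/
def betaBound (n : ℕ) : ℝ := Classical.choose (exists_bound_iteratedDeriv_unitPartitionC n)

/-- `1 ≤ betaBound n`. [folklore] -/
theorem one_le_betaBound (n : ℕ) : 1 ≤ betaBound n :=
  (Classical.choose_spec (exists_bound_iteratedDeriv_unitPartitionC n)).1

/-- `‖β_ℂ⁽ⁱ⁾(s)‖ ≤ betaBound n` for `i ≤ n`. [folklore] -/
theorem norm_iteratedDeriv_unitPartitionC_le_betaBound {i n : ℕ} (hi : i ≤ n) (s : ℝ) :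
    ‖iteratedDeriv i unitPartitionC s‖ ≤ betaBound n :=
  (Classical.choose_spec (exists_bound_iteratedDeriv_unitPartitionC n)).2 i hi s

/-- The ray derivative constant of order `n` (chosen from
`exists_norm_iteratedDeriv_colFn_ray_le`). [folklore] -/
def rayBound (R : BinQF) {a : ℤ} (ha : 0 < a) (b : ℤ) (L : ℝ) (m : ℤ) {Ch : ℝ} (hCh : 0 ≤ Ch)
    (S : ℝ) (n : ℕ) : ℝ :=
  Classical.choose (exists_norm_iteratedDeriv_colFn_ray_le R ha b L m n (S := S) hCh)

/-- `0 ≤ rayBound`. [folklore] -/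
theorem rayBound_nonneg (R : BinQF) {a : ℤ} (ha : 0 < a) (b : ℤ) (L : ℝ) (m : ℤ) {Ch : ℝ}
    (hCh : 0 ≤ Ch) (S : ℝ) (n : ℕ) : 0 ≤ rayBound R ha b L m hCh S n :=
  (Classical.choose_spec (exists_norm_iteratedDeriv_colFn_ray_le R ha b L m n (S := S) hCh)).1

/-- The defining bound of `rayBound`: `‖∂ⁿ_u colFn(u, us)‖ ≤ rayBound n · (Y₁/|u|)ⁿ`. [cite: Ngo2024, §3.5 Lemma 3.17] -/
theorem norm_iteratedDeriv_colFn_ray_le_rayBound (R : BinQF) {a : ℤ} (ha : 0 < a) (b : ℤ) (L : ℝ)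
    (m : ℤ) {Ch : ℝ} (hCh : 0 ≤ Ch) (S : ℝ) (n : ℕ) {x Y₁ : ℝ} {h : ℤ} {s u : ℝ} (hx : 0 < x)
    (hY : 2 ≤ Y₁) (hh : |(h : ℝ)| ≤ Ch * x) (hs : |s| ≤ S) (hu : u ≠ 0) :
    ‖iteratedDeriv n (fun v => colFn R a b x Y₁ h L m v (v * s)) u‖ ≤
      rayBound R ha b L m hCh S n * (Y₁ / |u|) ^ n :=
  (Classical.choose_spec (exists_norm_iteratedDeriv_colFn_ray_le R ha b L m n (S := S) hCh)).2
    x Y₁ h s u hx hY hh hs hu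

/-- `max_{i ≤ n}` of the ray constants (as a sum of nonnegative terms). [folklore] -/
def rayBoundMax (R : BinQF) {a : ℤ} (ha : 0 < a) (b : ℤ) (L : ℝ) (m : ℤ) {Ch : ℝ} (hCh : 0 ≤ Ch)
    (S : ℝ) (n : ℕ) : ℝ :=
  ∑ i ∈ Finset.range (n + 1), rayBound R ha b L m hCh S i

/-- `0 ≤ rayBoundMax`. [folklore] -/
theorem rayBoundMax_nonneg (R : BinQF) {a : ℤ} (ha : 0 < a) (b : ℤ) (L : ℝ) (m : ℤ) {Ch : ℝ}
    (hCh : 0 ≤ Ch) (S : ℝ) (n : ℕ) : 0 ≤ rayBoundMax R ha b L m hCh S n :=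
  Finset.sum_nonneg fun i _ => rayBound_nonneg R ha b L m hCh S i

/-- `rayBound i ≤ rayBoundMax n` for `i ≤ n`. [folklore] -/
theorem rayBound_le_rayBoundMax (R : BinQF) {a : ℤ} (ha : 0 < a) (b : ℤ) (L : ℝ) (m : ℤ) {Ch : ℝ}
    (hCh : 0 ≤ Ch) (S : ℝ) {i n : ℕ} (hi : i ≤ n) :
    rayBound R ha b L m hCh S i ≤ rayBoundMax R ha b L m hCh S n := by
  unfold rayBoundMax
  exact Finset.single_le_sum (fun j _ => rayBound_nonneg R ha b L m hCh S j)
    (Finset.mem_range.2 (Nat.lt_succ_of_le hi))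

/-- **The constant family for the modulus variable**: `A_f(n)`. [folklore] -/
def fConst (R : BinQF) {a : ℤ} (ha : 0 < a) (b : ℤ) (L : ℝ) (m : ℤ) {Ch : ℝ} (hCh : 0 ≤ Ch)
    (S : ℝ) (n : ℕ) : ℝ :=
  2 ^ (2 * n + 1) * n.factorial * betaBound n * rayBoundMax R ha b L m hCh S n * (3 * n + 3) ^ n

/-- `0 ≤ fConst`. [folklore] -/
theorem fConst_nonneg (R : BinQF) {a : ℤ} (ha : 0 < a) (b : ℤ) (L : ℝ) (m : ℤ) {Ch : ℝ}
    (hCh : 0 ≤ Ch) (S : ℝ) (n : ℕ) : 0 ≤ fConst R ha b L m hCh S n := by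
  unfold fConst
  have := one_le_betaBound n
  have := rayBoundMax_nonneg R ha b L m hCh S n
  positivity

/-- **The constant family for the frequency variable**: `A_g(n) = 2ⁿ n! M_β(n) (3n+3)ⁿ`. [folklore] -/
def gConst (n : ℕ) : ℝ := 2 ^ n * n.factorial * betaBound n * (3 * n + 3) ^ n

/-- `0 ≤ gConst`. [folklore] -/
theorem gConst_nonneg (n : ℕ) : 0 ≤ gConst n := by
  unfold gConst; have := one_le_betaBound n; positivity

/-! ### The identity embedding `v ↦ (v : ℂ)` -/

/-- `deriv (v ↦ (v : ℂ)) = 1`. [folklore] -/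
theorem deriv_ofReal_eq : deriv (fun v : ℝ => (v : ℂ)) = fun _ => (1 : ℂ) := by
  funext v
  have h : HasDerivAt (fun y : ℝ => ((y : ℝ) : ℂ)) ((1 : ℝ) : ℂ) v := (hasDerivAt_id v).ofReal_comp
  rw [h.deriv, Complex.ofReal_one]

/-- `∂ⁱ (v ↦ (v : ℂ))`: `v`, `1`, `0, 0, …`. [folklore] -/
theorem iteratedDeriv_ofReal (i : ℕ) (u : ℝ) :
    iteratedDeriv i (fun v : ℝ => (v : ℂ)) u = if i = 0 then (u : ℂ) else if i = 1 then 1 else 0 := by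
  rcases i with _ | _ | i
  · simp
  · rw [iteratedDeriv_one, deriv_ofReal_eq]; simp
  · rw [iteratedDeriv_succ', iteratedDeriv_succ', deriv_ofReal_eq, deriv_const']
    simp

/-- **Bounds for `v ↦ (v : ℂ)`**: if `0 ≤ u ≤ B` and `1 ≤ Bλ` (`λ ≥ 0`), then
`‖∂ⁱ (v : ℂ)(u)‖ ≤ B λⁱ` for all `i`. [folklore] -/
theorem norm_iteratedDeriv_ofReal_le {u B lam : ℝ} (hu0 : 0 ≤ u) (huB : u ≤ B) (hl0 : 0 ≤ lam)
    (hBl : 1 ≤ B * lam) (i : ℕ) :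
    ‖iteratedDeriv i (fun v : ℝ => (v : ℂ)) u‖ ≤ B * lam ^ i := by
  have hB : 0 ≤ B := hu0.trans huB
  rw [iteratedDeriv_ofReal]
  rcases i with _ | _ | i
  · simp only [if_true, Complex.norm_real, Real.norm_eq_abs, abs_of_nonneg hu0, pow_zero, mul_one]
    exact huB
  · simp only [Nat.succ_ne_zero, if_false, if_true, norm_one, zero_add, pow_one]
    exact hBl
  · have h2 : i + 1 + 1 ≠ 1 := by omega
    simp only [Nat.succ_ne_zero, h2, if_false, norm_zero]
    positivity

/-! ### The modulus weight `f_s(u) = σ_k(λu) · u · colFn(u, us)` -/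

section rayWeight

variable {R : BinQF} {a : ℤ}

/-- `u ↦ colFn(u, us)` is smooth on `{u ≠ 0}` (the explicit ray formula `colFn_ray`). [folklore] -/
theorem contDiffOn_colFn_ray (R : BinQF) (a b : ℤ) (x Y₁ : ℝ) (h : ℤ) (L : ℝ) (m : ℤ) (s : ℝ) :
    ContDiffOn ℝ ∞ (fun v => colFn R a b x Y₁ h L m v (v * s)) {v : ℝ | v ≠ 0} := by
  have hUo : IsOpen {v : ℝ | v ≠ 0} := isOpen_compl_singleton
  intro u hu
  by_cases hr : colA R 1 s = 0
  · have hev : (fun v => colFn R a b x Y₁ h L m v (v * s)) =ᶠ[nhds u] fun _ => (0 : ℂ) := by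
      filter_upwards [hUo.mem_nhds hu] with v hv
      rw [colFn_ray R a b x Y₁ h L m hv s, if_pos hr]
    exact ((contDiffAt_const (c := (0 : ℂ))).congr_of_eventuallyEq hev).contDiffWithinAt
  · set c := rayCoef R b s with hc
    set r := colA R 1 s with hrdef
    have hev : (fun v => colFn R a b x Y₁ h L m v (v * s)) =ᶠ[nhds u] fun v =>
        ((colPsi R L m 1 s : ℝ) : ℂ) * (((tothPlateau x Y₁ (v ^ 2 * r / a) : ℝ) : ℂ) *
          ex (h * (c * (v ^ 2)⁻¹))) := by
      filter_upwards [hUo.mem_nhds hu] with v hv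
      rw [colFn_ray R a b x Y₁ h L m hv s, if_neg hr]
      ring
    have hP : ContDiffAt ℝ ∞ (fun v : ℝ => ((tothPlateau x Y₁ (v ^ 2 * r / a) : ℝ) : ℂ)) u :=
      (Complex.ofRealCLM.contDiff.comp ((contDiff_tothPlateau x Y₁).comp (by fun_prop))).contDiffAt
    have hE : ContDiffAt ℝ ∞ (fun v : ℝ => ex (h * (c * (v ^ 2)⁻¹))) u :=
      contDiff_ex.contDiffAt.comp u (contDiffAt_const.mul (contDiffAt_const.mul
        ((contDiffAt_id.pow 2).inv (pow_ne_zero 2 hu))))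
    exact ((contDiffAt_const.mul (hP.mul hE)).congr_of_eventuallyEq hev).contDiffWithinAt

/-- **The modulus weight** `f_s(u) = σ_k(λu) · u · colFn(u, us)` (`σ_k = dyadic k` rescaled by
`λ > 0`, so that the support is the box `(C, 2C)`, `C = K_k/λ`; the factor `u` comes from
`M_u⁻¹ 𝓕(colFn(u,·))(κ/M_u) = (ad)⁻¹ ∫ e(−sκ/(ad)) colFn(u, us) ds` against the `1/c` of
Theorem 2.5). [cite: Ngo2024, §3.5 Proposition 3.18 (proof), Lemma 3.17] -/
def rayWeight (R : BinQF) (a b : ℤ) (x Y₁ : ℝ) (h : ℤ) (L : ℝ) (m : ℤ) (k : ℤ) (lam s : ℝ)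
    (v : ℝ) : ℂ :=
  dyadic k (lam * v) * (v : ℂ) * colFn R a b x Y₁ h L m v (v * s)

/-- Near a point `u < C` the modulus weight vanishes identically. [folklore] -/
theorem rayWeight_eventuallyEq_zero_of_lt (R : BinQF) (a b : ℤ) (x Y₁ : ℝ) (h : ℤ) (L : ℝ) (m : ℤ)
    {k : ℤ} {lam : ℝ} (hlam : 0 < lam) (s : ℝ) {u : ℝ} (hu : u < dyScale k / lam) :
    rayWeight R a b x Y₁ h L m k lam s =ᶠ[nhds u] fun _ => (0 : ℂ) :=
  (dyadic_scaled_eventuallyEq_zero_of_lt hlam hu).mono fun v hv => by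
    simp only at hv; rw [rayWeight, hv, zero_mul, zero_mul]

/-- Near a point `u > 2C` the modulus weight vanishes identically. [folklore] -/
theorem rayWeight_eventuallyEq_zero_of_gt (R : BinQF) (a b : ℤ) (x Y₁ : ℝ) (h : ℤ) (L : ℝ) (m : ℤ)
    {k : ℤ} {lam : ℝ} (hlam : 0 < lam) (s : ℝ) {u : ℝ} (hu : 2 * (dyScale k / lam) < u) :
    rayWeight R a b x Y₁ h L m k lam s =ᶠ[nhds u] fun _ => (0 : ℂ) :=
  (dyadic_scaled_eventuallyEq_zero_of_gt hlam hu).mono fun v hv => by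
    simp only at hv; rw [rayWeight, hv, zero_mul, zero_mul]

/-- **The modulus weight is smooth on `ℝ`.** [folklore] -/
theorem contDiff_rayWeight (R : BinQF) (a b : ℤ) (x Y₁ : ℝ) (h : ℤ) (L : ℝ) (m : ℤ) (k : ℤ)
    {lam : ℝ} (hlam : 0 < lam) (s : ℝ) : ContDiff ℝ ∞ (rayWeight R a b x Y₁ h L m k lam s) := by
  refine contDiff_iff_contDiffAt.2 fun u => ?_
  by_cases hu : u < dyScale k / lam
  · exact (contDiffAt_const (c := (0 : ℂ))).congr_of_eventuallyEq
      (rayWeight_eventuallyEq_zero_of_lt R a b x Y₁ h L m hlam s hu)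
  · have hu0 : 0 < u := (div_pos (dyScale_pos k) hlam).trans_le (not_lt.1 hu)
    have hUo : IsOpen {v : ℝ | v ≠ 0} := isOpen_compl_singleton
    have hC : ContDiffAt ℝ ∞ (fun v => colFn R a b x Y₁ h L m v (v * s)) u :=
      (contDiffOn_colFn_ray R a b x Y₁ h L m s).contDiffAt (hUo.mem_nhds hu0.ne')
    exact (((contDiff_dyadic_scaled k lam).contDiffAt).mul
      Complex.ofRealCLM.contDiff.contDiffAt).mul hC

/-- The support of the modulus weight: `f_s(u) ≠ 0 ⇒ C < u < 2C`. [folklore] -/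
theorem rayWeight_support (R : BinQF) (a b : ℤ) (x Y₁ : ℝ) (h : ℤ) (L : ℝ) (m : ℤ) {k : ℤ}
    {lam : ℝ} (hlam : 0 < lam) {s u : ℝ} (hne : rayWeight R a b x Y₁ h L m k lam s u ≠ 0) :
    dyScale k / lam < u ∧ u < 2 * (dyScale k / lam) := by
  unfold rayWeight at hne
  exact dyadic_scaled_support hlam (left_ne_zero_of_mul (left_ne_zero_of_mul hne))

/-- **Ngo's Lemma 3.17 in the modulus variable**: for `x > 0`, `Y₁ ≥ 2`, `|h| ≤ C_h x`, `|s| ≤ S`,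
`C ≤ u ≤ 2C` (`C = K_k/λ`) and `I ≤ n`: `‖f_s⁽ᴵ⁾(u)‖ ≤ C · A_f(n) · (Y₁/C)ᴵ`.
[cite: Ngo2024, §3.5 Lemma 3.17, §3.6 Lemmas 3.20–3.22] -/
theorem norm_iteratedDeriv_rayWeight_le (R : BinQF) {a : ℤ} (ha : 0 < a) (b : ℤ) (L : ℝ) (m : ℤ)
    {Ch : ℝ} (hCh : 0 ≤ Ch) (S : ℝ) {x Y₁ : ℝ} (hx : 0 < x) (hY : 2 ≤ Y₁) {h : ℤ}
    (hh : |(h : ℝ)| ≤ Ch * x) {s : ℝ} (hs : |s| ≤ S) (k : ℤ) {lam : ℝ} (hlam : 0 < lam) {u : ℝ}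
    (hu1 : dyScale k / lam ≤ u) (hu2 : u ≤ 2 * (dyScale k / lam)) {I n : ℕ} (hIn : I ≤ n) :
    ‖iteratedDeriv I (rayWeight R a b x Y₁ h L m k lam s) u‖ ≤
      dyScale k / lam * fConst R ha b L m hCh S n * (Y₁ / (dyScale k / lam)) ^ I := by
  set Ck := dyScale k / lam with hCk
  have hCk0 : 0 < Ck := div_pos (dyScale_pos k) hlam
  have hu0 : 0 < u := hCk0.trans_le hu1
  have hY1 : 1 ≤ Y₁ := by linarith
  set lam' : ℝ := (3 * n + 3) * Y₁ / Ck with hlam'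
  have hn3 : (1 : ℝ) ≤ 3 * n + 3 := by linarith [(Nat.cast_nonneg n : (0 : ℝ) ≤ n)]
  have hlam0 : 0 ≤ lam' := by positivity
  have hlam1 : Y₁ / Ck ≤ lam' := by
    rw [hlam']
    exact div_le_div_of_nonneg_right (le_mul_of_one_le_left (by linarith) hn3) hCk0.le
  have hlam2 : (3 * n + 3) / Ck ≤ lam' := by
    rw [hlam']
    exact div_le_div_of_nonneg_right (le_mul_of_one_le_right (by positivity) hY1) hCk0.le
  set Mβ := betaBound n with hMβ
  have hMβ1 : 1 ≤ Mβ := one_le_betaBound n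
  set Amax := rayBoundMax R ha b L m hCh S n with hAmax
  have hAmax0 : 0 ≤ Amax := rayBoundMax_nonneg R ha b L m hCh S n
  -- the open set
  set U : Set ℝ := Set.Ioi 0 with hU
  have hUo : IsOpen U := isOpen_Ioi
  have huU : u ∈ U := hu0
  -- (A) the dyadic factor
  have hA : ∀ i ≤ n, ‖iteratedDeriv i (fun w => dyadic k (lam * w)) u‖ ≤ (n.factorial * Mβ) * lam' ^ i := by
    intro i hi
    refine (norm_iteratedDeriv_dyadic_scaled_le (zero_le_one.trans hMβ1)
      (fun j hj s => norm_iteratedDeriv_unitPartitionC_le_betaBound hj s) k hlam u hi).trans ?_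
    rw [← hCk]
    have h1 : (i.factorial : ℝ) ≤ n.factorial := by exact_mod_cast Nat.factorial_le hi
    have h2 : ((3 * n + 3) / Ck) ^ i ≤ lam' ^ i := pow_le_pow_left₀ (by positivity) hlam2 i
    exact mul_le_mul (mul_le_mul_of_nonneg_right h1 (by positivity)) h2 (by positivity) (by positivity)
  -- (B) the factor `u`
  have hB : ∀ i ≤ n, ‖iteratedDeriv i (fun v : ℝ => (v : ℂ)) u‖ ≤ (2 * Ck) * lam' ^ i := by
    intro i _
    refine norm_iteratedDeriv_ofReal_le hu0.le hu2 hlam0 ?_ i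
    -- `1 ≤ 2 C λ' = 2 (3n+3) Y₁`
    rw [hlam', show 2 * Ck * ((3 * n + 3) * Y₁ / Ck) = 2 * ((3 * n + 3) * Y₁) by field_simp]
    nlinarith
  -- (C) the column factor
  have hC : ∀ i ≤ n, ‖iteratedDeriv i (fun v => colFn R a b x Y₁ h L m v (v * s)) u‖ ≤ Amax * lam' ^ i := by
    intro i hi
    refine (norm_iteratedDeriv_colFn_ray_le_rayBound R ha b L m hCh S i hx hY hh hs hu0.ne').trans ?_
    have h1 : rayBound R ha b L m hCh S i ≤ Amax := rayBound_le_rayBoundMax R ha b L m hCh S hi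
    have h2 : (Y₁ / |u|) ^ i ≤ lam' ^ i := by
      refine pow_le_pow_left₀ (by positivity) (le_trans ?_ hlam1) i
      rw [abs_of_pos hu0]
      exact div_le_div_of_nonneg_left (by linarith) hCk0 hu1
    exact mul_le_mul h1 h2 (by positivity) hAmax0
  -- Leibniz, twice
  have hAon : ContDiffOn ℝ (⊤ : ℕ∞) (fun w => dyadic k (lam * w)) U :=
    (contDiff_dyadic_scaled k lam).contDiffOn
  have hBon : ContDiffOn ℝ (⊤ : ℕ∞) (fun v : ℝ => (v : ℂ)) U := Complex.ofRealCLM.contDiff.contDiffOn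
  have hCon : ContDiffOn ℝ (⊤ : ℕ∞) (fun v => colFn R a b x Y₁ h L m v (v * s)) U :=
    (contDiffOn_colFn_ray R a b x Y₁ h L m s).mono fun v hv => ne_of_gt hv
  have hAB : ∀ i ≤ n, ‖iteratedDeriv i (fun v => dyadic k (lam * v) * (v : ℂ)) u‖ ≤
      (2 ^ n * (n.factorial * Mβ) * (2 * Ck)) * lam' ^ i := by
    intro i hi
    have h1 := norm_iteratedDeriv_mul_le_of_isOpen (f := fun w => dyadic k (lam * w))
      (g := fun v : ℝ => (v : ℂ)) hUo
      hAon hBon huU (n := i) (Kf := n.factorial * Mβ) (Kg := 2 * Ck) (lam := lam') (by positivity)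
      hlam0 (fun j hj => hA j (hj.trans hi)) (fun j hj => hB j (hj.trans hi))
    refine h1.trans ?_
    have : (2 : ℝ) ^ i ≤ 2 ^ n := pow_le_pow_right₀ (by norm_num) hi
    have h2 : (2 : ℝ) ^ i * (n.factorial * Mβ) * (2 * Ck) ≤ 2 ^ n * (n.factorial * Mβ) * (2 * Ck) := by
      gcongr
    exact mul_le_mul_of_nonneg_right h2 (by positivity)
  have hABon : ContDiffOn ℝ (⊤ : ℕ∞) (fun v => dyadic k (lam * v) * (v : ℂ)) U := hAon.mul hBon
  have hfun : rayWeight R a b x Y₁ h L m k lam s =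
      fun v => (dyadic k (lam * v) * (v : ℂ)) * colFn R a b x Y₁ h L m v (v * s) := rfl
  rw [hfun]
  have h1 := norm_iteratedDeriv_mul_le_of_isOpen (f := fun v => dyadic k (lam * v) * (v : ℂ))
    (g := fun v => colFn R a b x Y₁ h L m v (v * s)) hUo hABon hCon huU (n := I)
    (Kf := 2 ^ n * (n.factorial * Mβ) * (2 * Ck)) (Kg := Amax) (lam := lam') (by positivity) hlam0
    (fun j hj => hAB j (hj.trans hIn)) (fun j hj => hC j (hj.trans hIn))
  refine h1.trans ?_
  -- the arithmetic: `2^I (2^n n! Mβ 2C) Amax λ'^I ≤ C fConst (Y₁/C)^I`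
  rw [fConst, ← hMβ, ← hAmax, hlam', div_pow, mul_pow]
  have e1 : (2 : ℝ) ^ I ≤ 2 ^ n := pow_le_pow_right₀ (by norm_num) hIn
  have e2 : ((3 : ℝ) * n + 3) ^ I ≤ (3 * n + 3) ^ n := pow_le_pow_right₀ hn3 hIn
  have hY0 : 0 ≤ Y₁ ^ I := by positivity
  have hCkI : 0 < Ck ^ I := by positivity
  rw [show (2 : ℝ) ^ (2 * n + 1) = 2 ^ n * 2 ^ n * 2 by ring, div_pow Y₁ Ck I]
  calc 2 ^ I * (2 ^ n * (n.factorial * Mβ) * (2 * Ck)) * Amax * ((3 * n + 3) ^ I * Y₁ ^ I / Ck ^ I)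
      = (2 ^ I * (3 * n + 3) ^ I) * (Ck * (2 ^ n * 2 * n.factorial * Mβ * Amax) * (Y₁ ^ I / Ck ^ I)) := by
        ring
    _ ≤ (2 ^ n * (3 * n + 3) ^ n) * (Ck * (2 ^ n * 2 * n.factorial * Mβ * Amax) * (Y₁ ^ I / Ck ^ I)) := by
        apply mul_le_mul_of_nonneg_right (mul_le_mul e1 e2 (by positivity) (by positivity))
        positivity
    _ = Ck * (2 ^ n * 2 ^ n * 2 * n.factorial * Mβ * Amax * (3 * n + 3) ^ n) * (Y₁ ^ I / Ck ^ I) := by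
        ring

/-- The derivatives of the modulus weight vanish at points `u < C`. [folklore] -/
theorem iteratedDeriv_rayWeight_eq_zero_of_lt (R : BinQF) (a b : ℤ) (x Y₁ : ℝ) (h : ℤ) (L : ℝ)
    (m : ℤ) {k : ℤ} {lam : ℝ} (hlam : 0 < lam) (s : ℝ) {u : ℝ} (hu : u < dyScale k / lam) (I : ℕ) :
    iteratedDeriv I (rayWeight R a b x Y₁ h L m k lam s) u = 0 := by
  rw [(rayWeight_eventuallyEq_zero_of_lt R a b x Y₁ h L m hlam s hu).iteratedDeriv_eq,
    iteratedDeriv_const]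
  split_ifs <;> rfl

/-- The derivatives of the modulus weight vanish at points `u > 2C`. [folklore] -/
theorem iteratedDeriv_rayWeight_eq_zero_of_gt (R : BinQF) (a b : ℤ) (x Y₁ : ℝ) (h : ℤ) (L : ℝ)
    (m : ℤ) {k : ℤ} {lam : ℝ} (hlam : 0 < lam) (s : ℝ) {u : ℝ} (hu : 2 * (dyScale k / lam) < u)
    (I : ℕ) :
    iteratedDeriv I (rayWeight R a b x Y₁ h L m k lam s) u = 0 := by
  rw [(rayWeight_eventuallyEq_zero_of_gt R a b x Y₁ h L m hlam s hu).iteratedDeriv_eq,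
    iteratedDeriv_const]
  split_ifs <;> rfl

end rayWeight

/-! ### The frequency weight `g(κ) = ρ_ℓ(κ) · e(cκ)` -/

section freqWeight

/-- **The frequency weight** `g(κ) = ρ_ℓ(κ) e(cκ)` (`ρ_ℓ = dyadic ℓ`; `c = −s/(ad)` in the
application). [cite: Ngo2024, §3.5 (3.15) (the factor `e(−yκ/(cN''))`), Proposition 3.18] -/
def freqWeight (ℓ : ℤ) (c : ℝ) (v : ℝ) : ℂ := dyadic ℓ v * ex (c * v)

/-- The frequency weight is smooth. [folklore] -/
theorem contDiff_freqWeight (ℓ : ℤ) (c : ℝ) : ContDiff ℝ ∞ (freqWeight ℓ c) :=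
  (contDiff_dyadic ℓ).mul (contDiff_ex.comp (contDiff_const.mul contDiff_id))

/-- The support of the frequency weight: `g(κ) ≠ 0 ⇒ K_ℓ < κ < 2K_ℓ`. [folklore] -/
theorem freqWeight_support {ℓ : ℤ} {c v : ℝ} (hne : freqWeight ℓ c v ≠ 0) :
    dyScale ℓ < v ∧ v < 2 * dyScale ℓ :=
  dyadic_support (left_ne_zero_of_mul hne)

/-- `‖∂ⁱ e(c·)(κ)‖ = (2π|c|)ⁱ`. [folklore] -/
theorem norm_iteratedDeriv_ex_const_mul (c : ℝ) (i : ℕ) (κ : ℝ) :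
    ‖iteratedDeriv i (fun v => ex (c * v)) κ‖ = (2 * Real.pi * |c|) ^ i := by
  have h := iteratedDeriv_comp_const_smul (n := i) (f := ex)
    ((contDiff_ex (n := ⊤)).of_le (by exact_mod_cast le_top)) c
  rw [h]
  simp only [norm_smul, norm_pow, Real.norm_eq_abs, norm_iteratedDeriv_ex]
  rw [mul_pow]; ring

/-- **Derivatives of the frequency weight**: for `μ ≥ (3n+3)/K_ℓ` and `μ ≥ 2π|c|`, `J ≤ n`:
`‖g⁽ᴶ⁾(κ)‖ ≤ 2ᴶ n! M_β(n) μᴶ`. [cite: Ngo2024, §3.5 Lemma 3.17] -/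
theorem norm_iteratedDeriv_freqWeight_le_of_rate (ℓ : ℤ) (c : ℝ) {n J : ℕ} (hJ : J ≤ n) (κ : ℝ)
    {μ : ℝ} (hμ1 : (3 * n + 3) / dyScale ℓ ≤ μ) (hμ2 : 2 * Real.pi * |c| ≤ μ) :
    ‖iteratedDeriv J (freqWeight ℓ c) κ‖ ≤ 2 ^ J * (n.factorial * betaBound n) * 1 * μ ^ J := by
  have hMβ1 : 1 ≤ betaBound n := one_le_betaBound n
  have hμ0 : 0 ≤ μ := le_trans (by positivity) hμ2
  have hA : ∀ i ≤ n, ‖iteratedDeriv i (dyadic ℓ) κ‖ ≤ (n.factorial * betaBound n) * μ ^ i := by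
    intro i hi
    refine (norm_iteratedDeriv_dyadic_le_scale (zero_le_one.trans hMβ1)
      (fun j hj s => norm_iteratedDeriv_unitPartitionC_le_betaBound hj s) ℓ κ hi).trans ?_
    have h1 : (i.factorial : ℝ) ≤ n.factorial := by exact_mod_cast Nat.factorial_le hi
    have hpos : 0 ≤ (3 * (n : ℝ) + 3) / dyScale ℓ := by
      have := dyScale_pos ℓ; positivity
    have h2 : ((3 * n + 3) / dyScale ℓ) ^ i ≤ μ ^ i := pow_le_pow_left₀ hpos hμ1 i
    exact mul_le_mul (mul_le_mul_of_nonneg_right h1 (by positivity)) h2 (by positivity) (by positivity)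
  have hE : ∀ i ≤ n, ‖iteratedDeriv i (fun v => ex (c * v)) κ‖ ≤ 1 * μ ^ i := by
    intro i _
    rw [norm_iteratedDeriv_ex_const_mul, one_mul]
    exact pow_le_pow_left₀ (by positivity) hμ2 i
  have hfun : freqWeight ℓ c = fun v => dyadic ℓ v * ex (c * v) := rfl
  rw [hfun]
  exact norm_iteratedDeriv_mul_le_of_isOpen (f := dyadic ℓ) (g := fun v => ex (c * v)) isOpen_univ
    (contDiff_dyadic ℓ).contDiffOn ((contDiff_ex.comp (contDiff_const.mul contDiff_id)).contDiffOn)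
    (Set.mem_univ κ) (n := J) (by positivity) hμ0 (fun i hi => hA i (hi.trans hJ))
    (fun i hi => hE i (hi.trans hJ))

/-- **Derivatives of the frequency weight, Theorem-2.5 form**: if `Y ≥ 1` and `2π|c|K_ℓ ≤ Y`, then
`‖g⁽ᴶ⁾(κ)‖ ≤ A_g(J) (Y/K_ℓ)ᴶ`. [cite: Ngo2024, §3.5 Lemma 3.17] -/
theorem norm_iteratedDeriv_freqWeight_le (ℓ : ℤ) (c : ℝ) {Y : ℝ} (hY : 1 ≤ Y)
    (hcY : 2 * Real.pi * |c| * dyScale ℓ ≤ Y) (J : ℕ) (κ : ℝ) :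
    ‖iteratedDeriv J (freqWeight ℓ c) κ‖ ≤ gConst J * (Y / dyScale ℓ) ^ J := by
  have hK := dyScale_pos ℓ
  have hn3 : (1 : ℝ) ≤ 3 * J + 3 := by linarith [(Nat.cast_nonneg J : (0 : ℝ) ≤ J)]
  set μ : ℝ := (3 * J + 3) * Y / dyScale ℓ with hμ
  have hμ1 : (3 * J + 3) / dyScale ℓ ≤ μ := by
    rw [hμ]; exact div_le_div_of_nonneg_right (le_mul_of_one_le_right (by positivity) hY) hK.le
  have hμ2 : 2 * Real.pi * |c| ≤ μ := by
    rw [hμ, le_div_iff₀ hK]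
    calc 2 * Real.pi * |c| * dyScale ℓ ≤ Y := hcY
      _ ≤ (3 * J + 3) * Y := le_mul_of_one_le_left (by linarith) hn3
  refine (norm_iteratedDeriv_freqWeight_le_of_rate ℓ c le_rfl κ hμ1 hμ2).trans (le_of_eq ?_)
  rw [gConst, hμ, div_pow, mul_pow]
  ring

end freqWeight

/-! ### The product weight `V_s(u, κ) = C⁻¹ f_s(u) g(κ)` -/

section pieceWeight

variable {R : BinQF} {a : ℤ}

/-- **The weight of a dyadic piece**: `V_s(u, κ) = C⁻¹ · f_s(u) · g(κ)`, `C = K_k/λ`.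
[cite: Ngo2024, §3.5 Proposition 3.18 (proof: Theorem 2.5 applied to `g_j(c, κ, y)` for each `y`)] -/
def pieceWeight (R : BinQF) (a b : ℤ) (x Y₁ : ℝ) (h : ℤ) (L : ℝ) (m : ℤ) (k ℓ : ℤ) (lam s c : ℝ)
    (u κ : ℝ) : ℂ :=
  ((dyScale k / lam : ℝ) : ℂ)⁻¹ * rayWeight R a b x Y₁ h L m k lam s u * freqWeight ℓ c κ

/-- **The piece weight is smooth on `ℝ²`.** [folklore] -/
theorem contDiff_uncurry_pieceWeight (R : BinQF) (a b : ℤ) (x Y₁ : ℝ) (h : ℤ) (L : ℝ) (m : ℤ)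
    (k ℓ : ℤ) {lam : ℝ} (hlam : 0 < lam) (s c : ℝ) :
    ContDiff ℝ ∞ (Function.uncurry (pieceWeight R a b x Y₁ h L m k ℓ lam s c)) := by
  have hf := contDiff_rayWeight R a b x Y₁ h L m k hlam s
  have hg := contDiff_freqWeight ℓ c
  exact (contDiff_const.mul (hf.comp contDiff_fst)).mul (hg.comp contDiff_snd)

/-- **The support of the piece weight** lies in the open box `(C, 2C) × (K_ℓ, 2K_ℓ)`.
[cite: Ngo2024, §2.2 Theorem 2.5 (hypothesis)] -/
theorem pieceWeight_support (R : BinQF) (a b : ℤ) (x Y₁ : ℝ) (h : ℤ) (L : ℝ) (m : ℤ) {k ℓ : ℤ}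
    {lam : ℝ} (hlam : 0 < lam) {s c u κ : ℝ} (hne : pieceWeight R a b x Y₁ h L m k ℓ lam s c u κ ≠ 0) :
    dyScale k / lam < u ∧ u < 2 * (dyScale k / lam) ∧ dyScale ℓ < κ ∧ κ < 2 * dyScale ℓ := by
  unfold pieceWeight at hne
  obtain ⟨h1, h2⟩ := rayWeight_support R a b x Y₁ h L m hlam
    (right_ne_zero_of_mul (left_ne_zero_of_mul hne))
  obtain ⟨h3, h4⟩ := freqWeight_support (right_ne_zero_of_mul hne)
  exact ⟨h1, h2, h3, h4⟩

/-- **Mixed derivatives of a product weight factor.** [folklore] -/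
theorem iteratedDeriv_pieceWeight (R : BinQF) (a b : ℤ) (x Y₁ : ℝ) (h : ℤ) (L : ℝ) (m : ℤ)
    (k ℓ : ℤ) (lam s c : ℝ) (I J : ℕ) (u κ : ℝ) :
    iteratedDeriv I (fun u' => iteratedDeriv J
        (fun κ' => pieceWeight R a b x Y₁ h L m k ℓ lam s c u' κ') κ) u =
      ((dyScale k / lam : ℝ) : ℂ)⁻¹ * iteratedDeriv I (rayWeight R a b x Y₁ h L m k lam s) u *
        iteratedDeriv J (freqWeight ℓ c) κ := by
  unfold pieceWeight
  simp_rw [iteratedDeriv_const_mul_field]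
  rw [iteratedDeriv_mul_const_field, iteratedDeriv_const_mul_field]

/-- **The hypothesis of Theorem 2.5 for the piece weights**: for `x > 0`, `Y₁ ≥ 2`, `|h| ≤ C_h x`,
`|s| ≤ S`, `Y ≥ Y₁` and `2π|c| K_ℓ ≤ Y`, with `C = K_k/λ`, `K = K_ℓ`:
`‖∂_uᴵ ∂_κᴶ V_s(u, κ)‖ ≤ A_f(I) A_g(J) · Y^{I+J}/(Cᴵ Kᴶ)` for all real `u, κ` and all `I, J`.
[cite: Ngo2024, §2.2 Theorem 2.5 (hypothesis), §3.5 Lemma 3.17] -/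
theorem norm_iteratedDeriv_pieceWeight_le (R : BinQF) {a : ℤ} (ha : 0 < a) (b : ℤ) (L : ℝ) (m : ℤ)
    {Ch : ℝ} (hCh : 0 ≤ Ch) (S : ℝ) {x Y₁ : ℝ} (hx : 0 < x) (hY : 2 ≤ Y₁) {h : ℤ}
    (hh : |(h : ℝ)| ≤ Ch * x) {s : ℝ} (hs : |s| ≤ S) (k ℓ : ℤ) {lam : ℝ} (hlam : 0 < lam) {c Y : ℝ}
    (hYY : Y₁ ≤ Y) (hcY : 2 * Real.pi * |c| * dyScale ℓ ≤ Y) (I J : ℕ) (u κ : ℝ) :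
    ‖iteratedDeriv I (fun u' => iteratedDeriv J
        (fun κ' => pieceWeight R a b x Y₁ h L m k ℓ lam s c u' κ') κ) u‖ ≤
      fConst R ha b L m hCh S I * gConst J *
        (Y ^ (I + J) / ((dyScale k / lam) ^ I * dyScale ℓ ^ J)) := by
  have hCk : 0 < dyScale k / lam := div_pos (dyScale_pos k) hlam
  have hKl := dyScale_pos ℓ
  have hY1 : 1 ≤ Y := by linarith
  have hf0 := fConst_nonneg R ha b L m hCh S I
  have hg0 := gConst_nonneg J
  rw [iteratedDeriv_pieceWeight, norm_mul, norm_mul, norm_inv, Complex.norm_real, Real.norm_eq_abs,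
    abs_of_pos hCk]
  have hg := norm_iteratedDeriv_freqWeight_le ℓ c hY1 hcY J κ
  -- the modulus factor: zero outside `[C, 2C]`, bounded inside
  have hf : ‖iteratedDeriv I (rayWeight R a b x Y₁ h L m k lam s) u‖ ≤
      dyScale k / lam * fConst R ha b L m hCh S I * (Y / (dyScale k / lam)) ^ I := by
    by_cases hu1 : u < dyScale k / lam
    · rw [iteratedDeriv_rayWeight_eq_zero_of_lt R a b x Y₁ h L m hlam s hu1, norm_zero]; positivity
    by_cases hu2 : 2 * (dyScale k / lam) < u
    · rw [iteratedDeriv_rayWeight_eq_zero_of_gt R a b x Y₁ h L m hlam s hu2, norm_zero]; positivity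
    refine (norm_iteratedDeriv_rayWeight_le R ha b L m hCh S hx hY hh hs k hlam (not_lt.1 hu1)
      (not_lt.1 hu2) le_rfl).trans ?_
    have : (Y₁ / (dyScale k / lam)) ^ I ≤ (Y / (dyScale k / lam)) ^ I :=
      pow_le_pow_left₀ (by positivity) (div_le_div_of_nonneg_right hYY hCk.le) I
    exact mul_le_mul_of_nonneg_left this (by positivity)
  set C := dyScale k / lam with hCdef
  have hC0 : C ≠ 0 := hCk.ne'
  have hK0 : dyScale ℓ ≠ 0 := hKl.ne'
  rw [div_pow] at hf hg
  calc C⁻¹ * ‖iteratedDeriv I (rayWeight R a b x Y₁ h L m k lam s) u‖ *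
        ‖iteratedDeriv J (freqWeight ℓ c) κ‖
      ≤ C⁻¹ * (C * fConst R ha b L m hCh S I * (Y ^ I / C ^ I)) *
          (gConst J * (Y ^ J / dyScale ℓ ^ J)) :=
        mul_le_mul (mul_le_mul_of_nonneg_left hf (by positivity)) hg (norm_nonneg _) (by positivity)
    _ = fConst R ha b L m hCh S I * gConst J * (Y ^ (I + J) / (C ^ I * dyScale ℓ ^ J)) := by
        rw [pow_add]
        field_simp

end pieceWeight

/-! ### The dyadic pieces of the dual sums as `s`-integrals of Theorem-2.5 sums -/

section piece

variable {R : BinQF} {a : ℤ}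

/-- For `α > 0`: `((α.natAbs : ℕ) : ℂ) = α`. [folklore] -/
theorem natAbs_cast_complex_of_pos {α : ℤ} (hα : 0 < α) : ((α.natAbs : ℕ) : ℂ) = (α : ℂ) := by
  rw [← Int.cast_natCast, Int.natCast_natAbs, abs_of_pos hα]

/-- For `α > 0`: `((α.natAbs : ℕ) : ℝ) = α`. [folklore] -/
theorem natAbs_cast_real_of_pos {α : ℤ} (hα : 0 < α) : ((α.natAbs : ℕ) : ℝ) = (α : ℝ) := by
  rw [← Int.cast_natCast, Int.natCast_natAbs, abs_of_pos hα]

/-- **The Theorem-2.5 sum** `∑_{1≤κ≤N_κ} ∑_{1≤α≤N_α} S_α(h, κ)/α · V(α, κ)` of the complete sums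
`S_α = colExpSum` against a weight `V`. [cite: Ngo2024, §2.2 Theorem 2.5 (left-hand side)] -/
def pittSum (a : ℤ) (d : ℕ) (R : BinQF) (h : ℤ) (V : ℝ → ℝ → ℂ) (Nα Nκ : ℤ) : ℂ :=
  ∑ κ ∈ Finset.Icc 1 Nκ, ∑ α ∈ Finset.Icc 1 Nα, colExpSum a d R h α κ / (α : ℂ) * V α κ

/-- **A dyadic piece of the dual Tóth sum** (positive moduli `1 ≤ α ≤ N_α`, positive frequencies
`1 ≤ κ ≤ N_κ`, weights `ρ_ℓ(κ) σ_k(α)`):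
`∑_α ∑_κ M_α⁻¹ 𝓕(colFn(α,·))(κ/M_α) S_α(h,κ) ρ_ℓ(κ) σ_k(α)`. [cite: Ngo2024, §3.5 Proposition 3.18 (proof)] -/
def pieceSum (a : ℤ) (d : ℕ) (R : BinQF) (b : ℤ) (x Y₁ : ℝ) (h : ℤ) (L : ℝ) (m : ℤ) (k ℓ : ℤ)
    (lam : ℝ) (Nα Nκ : ℤ) : ℂ :=
  ∑ α ∈ Finset.Icc 1 Nα, ∑ κ ∈ Finset.Icc 1 Nκ,
    (((α.natAbs * (a.toNat * d) : ℕ) : ℂ))⁻¹ *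
      (𝓕 (fun t => colFn R a b x Y₁ h L m α t) ((κ : ℝ) / ((α.natAbs * (a.toNat * d) : ℕ) : ℝ)) *
        colExpSum a d R h α κ * dyadic ℓ κ) * dyadic k (lam * α)

/-- The ray integrand `s ↦ colFn(α, αs) e(−sκ/q)` is integrable (continuous, compact support).
[folklore] -/
theorem integrable_colFn_ray_mul_ex (hA : R.a ≠ 0) (hΔ : 0 < R.disc) (ha : 0 < a) (b : ℤ)
    {x Y₁ : ℝ} (hx : 0 < x) (hY : 2 ≤ Y₁) (h : ℤ) {L : ℝ} (hL : 0 < L) (m : ℤ) {α : ℝ} (hα : α ≠ 0)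
    (c : ℝ) :
    Integrable (fun s : ℝ => colFn R a b x Y₁ h L m α (α * s) * ex (c * s)) := by
  have hcont : Continuous (fun s : ℝ => colFn R a b x Y₁ h L m α (α * s) * ex (c * s)) :=
    ((contDiff_colFn hA hΔ ha b hx hY h hL m hα (n := 0)).continuous.comp
      (continuous_const.mul continuous_id)).mul
      ((contDiff_ex (n := 0)).continuous.comp (continuous_const.mul continuous_id))
  have hsupp1 : HasCompactSupport (fun s : ℝ => colFn R a b x Y₁ h L m α (α * s)) := by
    have hc := (hasCompactSupport_colFn hA hΔ ha b hx hY h hL m α).comp_homeomorph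
      (Homeomorph.mulLeft₀ α hα)
    have heq : ((fun t => colFn R a b x Y₁ h L m α t) ∘ (Homeomorph.mulLeft₀ α hα)) =
        fun s : ℝ => colFn R a b x Y₁ h L m α (α * s) := by
      funext s; simp only [Function.comp_apply, Homeomorph.coe_mulLeft₀]
    rwa [heq] at hc
  exact hcont.integrable_of_hasCompactSupport hsupp1.mul_right

/-- **The piece as an `s`-integral of Theorem-2.5 sums**:
`pieceSum = (ad)⁻¹ C_k ∫ pittSum(V_s) ds` with the piece weights `V_s` (`c = −s/(ad)`), by
`fourier_colFn_eq_ray` (`α > 0`) and the interchange of the finite sums with the integral.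
[cite: Ngo2024, §3.5 Proposition 3.18 (proof, (3.19))] -/
theorem pieceSum_eq_integral (hA : R.a ≠ 0) (hΔ : 0 < R.disc) (ha : 0 < a) (b : ℤ) {d : ℕ}
    (hd : 1 ≤ d) {x Y₁ : ℝ} (hx : 0 < x) (hY : 2 ≤ Y₁) (h : ℤ) {L : ℝ} (hL : 0 < L) (m : ℤ)
    (k ℓ : ℤ) {lam : ℝ} (hlam : 0 < lam) (Nα Nκ : ℤ) :
    pieceSum a d R b x Y₁ h L m k ℓ lam Nα Nκ =
      ((((a.toNat * d : ℕ) : ℝ) : ℂ))⁻¹ * ((dyScale k / lam : ℝ) : ℂ) *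
        ∫ s : ℝ, pittSum a d R h
          (pieceWeight R a b x Y₁ h L m k ℓ lam s (-(s / ((a.toNat * d : ℕ) : ℝ)))) Nα Nκ := by
  set q : ℕ := a.toNat * d with hq
  have hq0 : 0 < q := Nat.mul_pos (by omega) (by omega)
  have hqr : (0 : ℝ) < q := by exact_mod_cast hq0
  have hqc : ((q : ℝ) : ℂ) ≠ 0 := by exact_mod_cast hqr.ne'
  have hCk : ((dyScale k / lam : ℝ) : ℂ) ≠ 0 := by exact_mod_cast (div_pos (dyScale_pos k) hlam).ne'
  -- the basic integrands
  set Φ : ℤ → ℤ → ℝ → ℂ := fun α κ s =>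
    colFn R a b x Y₁ h L m α (α * s) * ex (-(s / q) * κ) with hΦ
  have hΦ' : ∀ α κ : ℤ, Φ α κ = fun s : ℝ =>
      colFn R a b x Y₁ h L m α (α * s) * ex ((-(κ : ℝ) / q) * s) := by
    intro α κ; funext s; simp only [hΦ]; congr 2; ring
  have hΦint : ∀ α : ℤ, α ≠ 0 → ∀ κ : ℤ, Integrable (Φ α κ) := by
    intro α hα κ
    rw [hΦ' α κ]
    exact integrable_colFn_ray_mul_ex hA hΔ ha b hx hY h hL m (by exact_mod_cast hα) _
  -- the summands of `pittSum (V_s)` are constant multiples of `Φ α κ`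
  have hterm : ∀ (α κ : ℤ) (s : ℝ),
      colExpSum a d R h α κ / (α : ℂ) *
          pieceWeight R a b x Y₁ h L m k ℓ lam s (-(s / ((q : ℕ) : ℝ))) α κ =
        (colExpSum a d R h α κ / (α : ℂ) * ((dyScale k / lam : ℝ) : ℂ)⁻¹ *
          (dyadic k (lam * α) * (α : ℂ)) * dyadic ℓ κ) * Φ α κ s := by
    intro α κ s
    simp only [pieceWeight, rayWeight, freqWeight, hΦ]
    push_cast
    ring
  have hint : ∀ (α κ : ℤ), α ≠ 0 → Integrable (fun s : ℝ => colExpSum a d R h α κ / (α : ℂ) *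
      pieceWeight R a b x Y₁ h L m k ℓ lam s (-(s / ((q : ℕ) : ℝ))) α κ) := by
    intro α κ hα
    simp_rw [hterm]
    exact (hΦint α hα κ).const_mul _
  -- interchange the finite sums with the integral
  have hswap : ∫ s : ℝ, pittSum a d R h
      (pieceWeight R a b x Y₁ h L m k ℓ lam s (-(s / ((q : ℕ) : ℝ)))) Nα Nκ =
      ∑ κ ∈ Finset.Icc 1 Nκ, ∑ α ∈ Finset.Icc 1 Nα,
        (colExpSum a d R h α κ / (α : ℂ) * ((dyScale k / lam : ℝ) : ℂ)⁻¹ *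
          (dyadic k (lam * α) * (α : ℂ)) * dyadic ℓ κ) * ∫ s : ℝ, Φ α κ s := by
    unfold pittSum
    rw [integral_finsetSum]
    · refine Finset.sum_congr rfl fun κ _ => ?_
      rw [integral_finsetSum]
      · refine Finset.sum_congr rfl fun α hα => ?_
        rw [Finset.mem_Icc] at hα
        simp_rw [hterm]
        exact integral_const_mul _ _
      · intro α hα
        rw [Finset.mem_Icc] at hα
        exact hint α κ (by omega)
    · intro κ _
      refine integrable_finsetSum _ fun α hα => ?_
      rw [Finset.mem_Icc] at hα
      exact hint α κ (by omega)
  rw [hswap, pieceSum, Finset.sum_comm, Finset.mul_sum]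
  refine Finset.sum_congr rfl fun κ _ => ?_
  rw [Finset.mul_sum]
  refine Finset.sum_congr rfl fun α hα => ?_
  rw [Finset.mem_Icc] at hα
  have hα0 : 0 < α := by omega
  have hαc : (α : ℂ) ≠ 0 := by exact_mod_cast hα0.ne'
  -- the left-hand term through the ray formula
  rw [fourier_colFn_eq_ray R a b x Y₁ h L m hα0.ne' d κ, Int.sign_eq_one_of_pos hα0, ← hq]
  have hI : ∫ s : ℝ, ((𝐞 (-(((1 : ℤ) : ℝ) * s * κ / ((q : ℕ) : ℝ))) : Circle) : ℂ) *
      colFn R a b x Y₁ h L m (α.natAbs : ℕ) ((α.natAbs : ℕ) * s) = ∫ s : ℝ, Φ α κ s := by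
    refine integral_congr_ae (Filter.Eventually.of_forall fun s => ?_)
    simp only [hΦ]
    -- `(𝐞 y : ℂ) = ex y` (cf. the tree's `IwaniecAlmostPrimesRootExpSum.fourierChar_eq_exp`)
    have fc_ex : ∀ y : ℝ, ((𝐞 y : Circle) : ℂ) = ex y := fun y => by
      rw [Real.fourierChar_apply, ex]; congr 1; push_cast; ring
    rw [fc_ex, natAbs_cast_real_of_pos hα0, mul_comm]
    congr 2
    push_cast
    ring
  have hK' : ((dyScale k : ℝ) : ℂ) ≠ 0 := by exact_mod_cast (dyScale_pos k).ne'
  have hlam' : ((lam : ℝ) : ℂ) ≠ 0 := by exact_mod_cast hlam.ne'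
  rw [hI, Nat.cast_mul, natAbs_cast_complex_of_pos hα0]
  push_cast
  field_simp

end piece

end RootForms

end Literature.NumberTheory.Sieve

/-!
## Part 2. The dual Tóth sums: decomposition into dyadic pieces and the piece bounds

Topic `Literature/NumberTheory/Sieve`, continuation of Part 1.  This file
carries out the bookkeeping of T. Ngo's proof of his Proposition 3.18 (arXiv:2107.13301, §3.5) for
the Poisson-dual Tóth sums `∑_{0<|α|≤A} M_α⁻¹ ∑_κ 𝓕(colFn(α,·))(κ/M_α) S_α(h,κ)` of
`…TothColumnSum.tothSum_eq_dualSum`: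

* `pittBoundFn q K C Y g ε` — the right-hand side of Theorem 2.5 (Pitt's bound), monotone in
  `K, C, g` (`pittBoundFn_mono`);
* `norm_pieceSum_le` — a dyadic piece is `≪ (ad)⁻¹ · C · 2S · K_c · pittBoundFn(ad, K_ℓ, C, Y, (h,ad), ε)`
  as soon as the Theorem-2.5 bound holds for the piece weights `V_s` (`|s| ≤ S`; the integrand
  vanishes for `|s| > S`);
* the decomposition of the dual sum into the `κ = 0` column, the tail `|κ| > K₀` and the main part
  (`tsum_dualTerm_split`), the main part as `2(P(h) + conj P(−h))` over positive moduli and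
  frequencies (`mainPart_eq`), and `P` as the double sum of the dyadic pieces (`posPart_eq_sum_pieceSum`).

## References

* T. Ngo, *On roots of quadratic congruences*, arXiv:2107.13301 (Bull. LMS 2024), §2.2 Theorem 2.5,
  §3.5 Lemmas 3.15–3.17, Proposition 3.18. [cite: Ngo2024, §2.2 Theorem 2.5, §3.5 Proposition 3.18]
* Á. Tóth, *Roots of quadratic congruences*, IMRN 2000, 719–739. [cite: Toth2000, §4]
-/

noncomputable section

namespace Literature.NumberTheory.Sieve

open scoped MatrixGroups ContDiff FourierTransform ComplexConjugate
open Literature.NumberTheory.QuadraticFields.Quadratic (BinQF)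
open Real Finset MeasureTheory

namespace RootForms

/-! ### Pitt's bound as a function of the parameters -/

/-- **The core of the right-hand side of Ngo's Theorem 2.5** (Pitt's bound) for moduli of level
`q`, frequency scale `K`, modulus scale `C`, derivative scale `Y` and gcd parameter `g = (h, q)`:
`K^{1/2}{(K^{1/4}q^{-1/4} + 1) C^{1/2} Y^{3/2} g^{1/4} + q^{1/2}(Y^{3/4} + K^{1/2}q^{-1/2}) Y^{7/4}}`
(the factor `(qYKC)^ε` is kept separate). [cite: Ngo2024, §2.2 Theorem 2.5] -/
def pittCore (q K C Y g : ℝ) : ℝ :=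
  K ^ (1 / 2 : ℝ) * ((K ^ (1 / 4 : ℝ) * q ^ (-(1 / 4) : ℝ) + 1) * C ^ (1 / 2 : ℝ) * Y ^ (3 / 2 : ℝ) *
      g ^ (1 / 4 : ℝ) +
    q ^ (1 / 2 : ℝ) * (Y ^ (3 / 4 : ℝ) + K ^ (1 / 2 : ℝ) * q ^ (-(1 / 2) : ℝ)) * Y ^ (7 / 4 : ℝ))

/-- **Pitt's bound** `pittCore · (qYKC)^ε` (the full right-hand side of Theorem 2.5). [cite: Ngo2024, §2.2 Theorem 2.5] -/
def pittBoundFn (q K C Y g ε : ℝ) : ℝ := pittCore q K C Y g * (q * Y * K * C) ^ ε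

/-- `0 ≤ pittCore` for nonnegative parameters. [folklore] -/
theorem pittCore_nonneg {q K C Y g : ℝ} (hq : 0 ≤ q) (hK : 0 ≤ K) (hC : 0 ≤ C) (hY : 0 ≤ Y)
    (hg : 0 ≤ g) : 0 ≤ pittCore q K C Y g := by
  unfold pittCore; positivity

/-- `0 ≤ pittBoundFn` for nonnegative parameters. [folklore] -/
theorem pittBoundFn_nonneg {q K C Y g : ℝ} (hq : 0 ≤ q) (hK : 0 ≤ K) (hC : 0 ≤ C) (hY : 0 ≤ Y)
    (hg : 0 ≤ g) (ε : ℝ) : 0 ≤ pittBoundFn q K C Y g ε := by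
  unfold pittBoundFn
  exact mul_nonneg (pittCore_nonneg hq hK hC hY hg) (by positivity)

/-- **Monotonicity** of Pitt's bound in `K`, `C` and `g` (all exponents are nonnegative). [folklore] -/
theorem pittBoundFn_mono {q K K' C C' Y g g' ε : ℝ} (hq : 0 ≤ q) (hε : 0 ≤ ε) (hK : 0 ≤ K)
    (hKK : K ≤ K') (hC : 0 ≤ C) (hCC : C ≤ C') (hY : 0 ≤ Y) (hg : 0 ≤ g) (hgg : g ≤ g') :
    pittBoundFn q K C Y g ε ≤ pittBoundFn q K' C' Y g' ε := by
  unfold pittBoundFn pittCore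
  have hK' : 0 ≤ K' := hK.trans hKK
  have hC' : 0 ≤ C' := hC.trans hCC
  have hg' : 0 ≤ g' := hg.trans hgg
  gcongr

/-! ### The bound for one dyadic piece -/

section pieceBound

variable {R : BinQF} {a : ℤ}

/-- `K_ℓ ≥ 1/2` for `ℓ ≥ −1` (indeed `≥ 2^{−1/2}`). [folklore] -/
theorem half_le_dyScale {ℓ : ℤ} (hℓ : -1 ≤ ℓ) : 1 / 2 ≤ dyScale ℓ :=
  dyScale_neg_two ▸ dyScale_mono (by omega)

/-- On a ray with `|s| > S` every column function vanishes, if `|t| ≤ S|u|` on the support. [folklore] -/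
theorem colFn_ray_eq_zero_of_lt {R : BinQF} {a b : ℤ} {x Y₁ : ℝ} {h : ℤ} {L : ℝ} {m : ℤ} {S : ℝ}
    (hS : ∀ u t : ℝ, colFn R a b x Y₁ h L m u t ≠ 0 → |t| ≤ S * |u|) {s : ℝ} (hs : S < |s|)
    {u : ℝ} (hu : u ≠ 0) : colFn R a b x Y₁ h L m u (u * s) = 0 := by
  by_contra hne
  have h1 := hS u (u * s) hne
  rw [abs_mul, mul_comm S] at h1
  have h2 : |s| ≤ S := le_of_mul_le_mul_left h1 (abs_pos.2 hu)
  linarith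

/-- **The bound for one dyadic piece**: if Theorem 2.5's conclusion holds for the piece weights
with constant `K_c` (hypothesis `hKc`: the bound of Ngo's Theorem 2.5 for the complete sums
`S_α(h,κ) = colExpSum` and the constant family `A(I,J) = A_f(I) A_g(J)`), then
`‖piece(k, ℓ)‖ ≤ (ad)⁻¹ · C · 2S · K_c · pittBoundFn(ad, K_ℓ, C, Y, (h, ad), ε)`, `C = K_k/λ`.
[cite: Ngo2024, §3.5 Proposition 3.18 (proof: (3.19)–(3.20))] -/
theorem norm_pieceSum_le (hA : R.a ≠ 0) (hΔ : 0 < R.disc) (ha : 0 < a) (b : ℤ) (L : ℝ) (m : ℤ)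
    {Ch : ℝ} (hCh : 0 ≤ Ch) {S : ℝ} (hS0 : 0 ≤ S) {d : ℕ} (hd : 1 ≤ d) {x Y₁ : ℝ} (hx : 0 < x)
    (hY : 2 ≤ Y₁) {h : ℤ} (hh : |(h : ℝ)| ≤ Ch * x) (hL : 0 < L)
    (hS : ∀ u t : ℝ, colFn R a b x Y₁ h L m u t ≠ 0 → |t| ≤ S * |u|)
    (k : ℤ) {ℓ : ℤ} (hℓ : -1 ≤ ℓ) {lam : ℝ} (hlam : 0 < lam) {Y : ℝ} (hYY : Y₁ ≤ Y)
    (hcY : 2 * Real.pi * (S / ((a.toNat * d : ℕ) : ℝ)) * dyScale ℓ ≤ Y) {Kc ε : ℝ} (hKc0 : 0 ≤ Kc)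
    (hKc : ∀ C K Y' : ℝ, 0 < C → 1 / 2 ≤ K → 1 ≤ Y' → ∀ V : ℝ → ℝ → ℂ,
      ContDiff ℝ ∞ (Function.uncurry V) →
      (∀ u κ, V u κ ≠ 0 → C < u ∧ u < 2 * C ∧ K < κ ∧ κ < 2 * K) →
      (∀ (I J : ℕ) (u κ : ℝ), ‖iteratedDeriv I (fun u' => iteratedDeriv J (fun κ' => V u' κ') κ) u‖ ≤
        fConst R ha b L m hCh S I * gConst J * (Y' ^ (I + J) / (C ^ I * K ^ J))) →
      ∀ Nα Nκ : ℤ, ‖pittSum a d R h V Nα Nκ‖ ≤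
        Kc * pittBoundFn ((a.toNat * d : ℕ) : ℝ) K C Y' (Int.gcd h (a * d)) ε)
    (Nα Nκ : ℤ) :
    ‖pieceSum a d R b x Y₁ h L m k ℓ lam Nα Nκ‖ ≤
      (((a.toNat * d : ℕ) : ℝ))⁻¹ * (dyScale k / lam) * (2 * S *
        (Kc * pittBoundFn ((a.toNat * d : ℕ) : ℝ) (dyScale ℓ) (dyScale k / lam) Y (Int.gcd h (a * d)) ε)) := by
  set q : ℕ := a.toNat * d with hq
  have hq0 : 0 < q := Nat.mul_pos (by omega) (by omega)
  have hqr : (0 : ℝ) < q := by exact_mod_cast hq0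
  have hC : 0 < dyScale k / lam := div_pos (dyScale_pos k) hlam
  have hY1 : 1 ≤ Y := by linarith
  set B₀ : ℝ := Kc * pittBoundFn (q : ℝ) (dyScale ℓ) (dyScale k / lam) Y (Int.gcd h (a * d)) ε with hB₀
  have hB₀0 : 0 ≤ B₀ := mul_nonneg hKc0 (pittBoundFn_nonneg hqr.le (dyScale_pos ℓ).le hC.le
    (by linarith) (Nat.cast_nonneg _) ε)
  rw [pieceSum_eq_integral hA hΔ ha b hd hx hY h hL m k ℓ hlam Nα Nκ, ← hq, norm_mul, norm_mul,
    norm_inv, Complex.norm_real, Complex.norm_real, Real.norm_eq_abs, Real.norm_eq_abs,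
    abs_of_pos hqr, abs_of_pos hC]
  refine mul_le_mul_of_nonneg_left ?_ (by positivity)
  -- pointwise bound for the integrand
  have hbound : ∀ s : ℝ, ‖pittSum a d R h (pieceWeight R a b x Y₁ h L m k ℓ lam s (-(s / (q : ℝ)))) Nα Nκ‖ ≤
      Set.indicator (Set.Icc (-S) S) (fun _ => B₀) s := by
    intro s
    by_cases hs : |s| ≤ S
    · rw [Set.indicator_of_mem (Set.mem_Icc.2 (abs_le.1 hs))]
      refine hKc (dyScale k / lam) (dyScale ℓ) Y hC (half_le_dyScale hℓ) hY1 _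
        (contDiff_uncurry_pieceWeight R a b x Y₁ h L m k ℓ hlam s _)
        (fun u κ hne => pieceWeight_support R a b x Y₁ h L m hlam hne) (fun I J u κ => ?_) Nα Nκ
      refine norm_iteratedDeriv_pieceWeight_le R ha b L m hCh S hx hY hh hs k ℓ hlam hYY ?_ I J u κ
      calc 2 * Real.pi * |(-(s / (q : ℝ)))| * dyScale ℓ
          = 2 * Real.pi * (|s| / (q : ℝ)) * dyScale ℓ := by rw [abs_neg, abs_div, abs_of_pos hqr]
        _ ≤ 2 * Real.pi * (S / (q : ℝ)) * dyScale ℓ := by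
            have := dyScale_pos ℓ
            gcongr
        _ ≤ Y := hcY
    · rw [Set.indicator_of_notMem (fun hm => hs (abs_le.2 (Set.mem_Icc.1 hm)))]
      have hzero : pittSum a d R h (pieceWeight R a b x Y₁ h L m k ℓ lam s (-(s / (q : ℝ)))) Nα Nκ = 0 := by
        refine Finset.sum_eq_zero fun κ _ => Finset.sum_eq_zero fun α hα => ?_
        rw [Finset.mem_Icc] at hα
        have hα0 : (α : ℝ) ≠ 0 := by exact_mod_cast (show α ≠ 0 by omega)
        rw [pieceWeight, rayWeight, colFn_ray_eq_zero_of_lt hS (not_le.1 hs) hα0]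
        simp
      rw [hzero, norm_zero]
  have hint : Integrable (Set.indicator (Set.Icc (-S) S) fun _ : ℝ => B₀) :=
    (integrableOn_const (C := B₀) (s := Set.Icc (-S) S) (μ := volume)
      (hs := measure_Icc_lt_top.ne)).integrable_indicator measurableSet_Icc
  calc ‖∫ s : ℝ, pittSum a d R h (pieceWeight R a b x Y₁ h L m k ℓ lam s (-(s / (q : ℝ)))) Nα Nκ‖
      ≤ ∫ s : ℝ, Set.indicator (Set.Icc (-S) S) (fun _ => B₀) s :=
        norm_integral_le_of_norm_le hint (Filter.Eventually.of_forall hbound)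
    _ = 2 * S * B₀ := by
        rw [integral_indicator_const _ measurableSet_Icc, Real.volume_real_Icc_of_le (by linarith),
          smul_eq_mul]
        ring

end pieceBound

/-! ### The decomposition of the dual sum -/

section decomposition

variable {R : BinQF} {a : ℤ}

/-- **The dual term** `F_α^{[h]}(κ) = 𝓕(colFn^{[h]}(α,·))(κ/M_α) · S_α(h, κ)`. [cite: Ngo2024, §3.5 Lemma 3.15] -/
def dualTerm (a : ℤ) (d : ℕ) (R : BinQF) (b : ℤ) (x Y₁ : ℝ) (h : ℤ) (L : ℝ) (m : ℤ) (α κ : ℤ) : ℂ :=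
  𝓕 (fun t => colFn R a b x Y₁ h L m α t) ((κ : ℝ) / ((α.natAbs * (a.toNat * d) : ℕ) : ℝ)) *
    colExpSum a d R h α κ

/-- The main weight `[κ ≠ 0] μ(|κ|)` of a real function `μ`. [folklore] -/
def wMain (μ : ℝ → ℝ) (κ : ℤ) : ℂ := if κ = 0 then 0 else ((μ |(κ : ℝ)| : ℝ) : ℂ)

/-- The tail weight `[κ ≠ 0] (1 − μ(|κ|))`. [folklore] -/
def wTail (μ : ℝ → ℝ) (κ : ℤ) : ℂ := if κ = 0 then 0 else (((1 - μ |(κ : ℝ)|) : ℝ) : ℂ)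

/-- `wMain` is even. [folklore] -/
theorem wMain_neg (μ : ℝ → ℝ) (κ : ℤ) : wMain μ (-κ) = wMain μ κ := by
  unfold wMain; rw [Int.cast_neg, abs_neg]; simp only [neg_eq_zero]

/-- `‖wMain‖ ≤ 1` when `0 ≤ μ ≤ 1` on `[1, ∞)`. [folklore] -/
theorem norm_wMain_le {μ : ℝ → ℝ} (hμ : ∀ v, 1 ≤ v → 0 ≤ μ v ∧ μ v ≤ 1) (κ : ℤ) : ‖wMain μ κ‖ ≤ 1 := by
  unfold wMain
  split_ifs with h0
  · simp
  · have h1 : (1 : ℝ) ≤ |(κ : ℝ)| := by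
      rw [← Int.cast_abs]; exact_mod_cast Int.one_le_abs h0
    rw [Complex.norm_real, Real.norm_eq_abs, abs_of_nonneg (hμ _ h1).1]
    exact (hμ _ h1).2

/-- `‖wTail‖ ≤ 1` when `0 ≤ μ ≤ 1` on `[1, ∞)`. [folklore] -/
theorem norm_wTail_le {μ : ℝ → ℝ} (hμ : ∀ v, 1 ≤ v → 0 ≤ μ v ∧ μ v ≤ 1) (κ : ℤ) : ‖wTail μ κ‖ ≤ 1 := by
  unfold wTail
  split_ifs with h0
  · simp
  · have h1 : (1 : ℝ) ≤ |(κ : ℝ)| := by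
      rw [← Int.cast_abs]; exact_mod_cast Int.one_le_abs h0
    have := hμ _ h1
    rw [Complex.norm_real, Real.norm_eq_abs, abs_of_nonneg (by linarith)]
    linarith

/-- **Splitting the frequency sum**: `∑_κ F(κ) = F(0) + ∑_κ F(κ) w_main(κ) + ∑_κ F(κ) w_tail(κ)`
(absolutely convergent `F`, weights bounded by `1`). [cite: Ngo2024, §3.5 Proposition 3.18 (proof: (3.19))] -/
theorem tsum_split {F : ℤ → ℂ} (hF : Summable fun κ => ‖F κ‖) {μ : ℝ → ℝ}
    (hμ : ∀ v, 1 ≤ v → 0 ≤ μ v ∧ μ v ≤ 1) :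
    ∑' κ, F κ = F 0 + ∑' κ, F κ * wMain μ κ + ∑' κ, F κ * wTail μ κ := by
  have hs0 : Summable fun κ : ℤ => F κ * (if κ = 0 then (1 : ℂ) else 0) :=
    Summable.of_norm_bounded hF fun κ => by
      split_ifs <;> simp
  have hs1 : Summable fun κ : ℤ => F κ * wMain μ κ :=
    Summable.of_norm_bounded hF fun κ => by
      rw [norm_mul]; exact mul_le_of_le_one_right (norm_nonneg _) (norm_wMain_le hμ κ)
  have hs2 : Summable fun κ : ℤ => F κ * wTail μ κ :=
    Summable.of_norm_bounded hF fun κ => by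
      rw [norm_mul]; exact mul_le_of_le_one_right (norm_nonneg _) (norm_wTail_le hμ κ)
  have hpt : ∀ κ : ℤ, F κ = F κ * (if κ = 0 then (1 : ℂ) else 0) + F κ * wMain μ κ + F κ * wTail μ κ := by
    intro κ
    unfold wMain wTail
    split_ifs with h0
    · simp
    · push_cast; ring
  have h0 : ∑' κ : ℤ, F κ * (if κ = 0 then (1 : ℂ) else 0) = F 0 := by
    rw [tsum_eq_single 0 (fun κ hκ => by rw [if_neg hκ, mul_zero])]
    simp
  calc ∑' κ, F κ = ∑' κ, (F κ * (if κ = 0 then (1 : ℂ) else 0) + F κ * wMain μ κ + F κ * wTail μ κ) :=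
        tsum_congr hpt
    _ = ∑' κ, (F κ * (if κ = 0 then (1 : ℂ) else 0) + F κ * wMain μ κ) + ∑' κ, F κ * wTail μ κ :=
        (hs0.add hs1).tsum_add hs2
    _ = F 0 + ∑' κ, F κ * wMain μ κ + ∑' κ, F κ * wTail μ κ := by
        rw [hs0.tsum_add hs1, h0]

/-- **The tail part is small**: if `w_tail(κ) ≠ 0 ⇒ K₀ < |κ|` and `‖w_tail‖ ≤ 1`, then
`‖M⁻¹ ∑_κ F(κ) w_tail(κ)‖ ≤ M⁻¹ ∑_κ [K₀ < |κ|] ‖𝓕‖‖S‖`. [cite: Ngo2024, §3.5 Lemma 3.16, Proposition 3.18 (proof)] -/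
theorem norm_tail_col_le (a : ℤ) (d : ℕ) (R : BinQF) (b : ℤ) (x Y₁ : ℝ) (h : ℤ) (L : ℝ) (m : ℤ)
    (α : ℤ) (hF : Summable fun κ => ‖dualTerm a d R b x Y₁ h L m α κ‖) {μ : ℝ → ℝ}
    (hμ : ∀ v, 1 ≤ v → 0 ≤ μ v ∧ μ v ≤ 1) {K₀ : ℝ} (hK₀ : ∀ κ : ℤ, wTail μ κ ≠ 0 → K₀ < |(κ : ℝ)|) :
    ‖(((α.natAbs * (a.toNat * d) : ℕ) : ℂ))⁻¹ * ∑' κ, dualTerm a d R b x Y₁ h L m α κ * wTail μ κ‖ ≤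
      (((α.natAbs * (a.toNat * d) : ℕ) : ℝ))⁻¹ *
        ∑' κ : ℤ, (if K₀ < |(κ : ℝ)| then
          ‖𝓕 (fun t => colFn R a b x Y₁ h L m α t) ((κ : ℝ) / ((α.natAbs * (a.toNat * d) : ℕ) : ℝ))‖ *
            ‖colExpSum a d R h α κ‖ else 0) := by
  rw [norm_mul, norm_inv, Complex.norm_natCast]
  refine mul_le_mul_of_nonneg_left ?_ (by positivity)
  have hle : ∀ κ : ℤ, ‖dualTerm a d R b x Y₁ h L m α κ * wTail μ κ‖ ≤
      (if K₀ < |(κ : ℝ)| then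
        ‖𝓕 (fun t => colFn R a b x Y₁ h L m α t) ((κ : ℝ) / ((α.natAbs * (a.toNat * d) : ℕ) : ℝ))‖ *
          ‖colExpSum a d R h α κ‖ else 0) := by
    intro κ
    by_cases hw : wTail μ κ = 0
    · rw [hw, mul_zero, norm_zero]; split_ifs <;> positivity
    · rw [if_pos (hK₀ κ hw), norm_mul, dualTerm, norm_mul]
      exact mul_le_of_le_one_right (by positivity) (norm_wTail_le hμ κ)
  have hle' : ∀ κ : ℤ, (if K₀ < |(κ : ℝ)| then
        ‖𝓕 (fun t => colFn R a b x Y₁ h L m α t) ((κ : ℝ) / ((α.natAbs * (a.toNat * d) : ℕ) : ℝ))‖ *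
          ‖colExpSum a d R h α κ‖ else 0) ≤ ‖dualTerm a d R b x Y₁ h L m α κ‖ := by
    intro κ
    split_ifs
    · rw [dualTerm, norm_mul]
    · positivity
  have hs1 : Summable fun κ : ℤ => ‖dualTerm a d R b x Y₁ h L m α κ * wTail μ κ‖ :=
    Summable.of_nonneg_of_le (fun κ => norm_nonneg _) (fun κ => (hle κ).trans (hle' κ)) hF
  have hs2 : Summable fun κ : ℤ => (if K₀ < |(κ : ℝ)| then
        ‖𝓕 (fun t => colFn R a b x Y₁ h L m α t) ((κ : ℝ) / ((α.natAbs * (a.toNat * d) : ℕ) : ℝ))‖ *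
          ‖colExpSum a d R h α κ‖ else 0) :=
    Summable.of_nonneg_of_le (fun κ => by split_ifs <;> positivity) hle' hF
  exact (norm_tsum_le_tsum_norm hs1).trans (hs1.tsum_le_tsum hle hs2)

/-- **The positive-frequency sum** `P_α^{[h]} = ∑_{1≤κ≤N} F_α^{[h]}(κ) μ(κ)`. [folklore] -/
def posSum (a : ℤ) (d : ℕ) (R : BinQF) (b : ℤ) (x Y₁ : ℝ) (h : ℤ) (L : ℝ) (m : ℤ) (μ : ℝ → ℝ)
    (α N : ℤ) : ℂ :=
  ∑ κ ∈ Finset.Icc 1 N, dualTerm a d R b x Y₁ h L m α κ * ((μ (κ : ℝ) : ℝ) : ℂ)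

/-- **The main part of a column over positive frequencies**: if `μ(v) = 0` for `v > N` (`N ≥ 0`),
`∑_κ F_α^{[h]}(κ) w_main(κ) = P_α^{[h]} + conj P_α^{[−h]}`. [cite: Ngo2024, §2.2 (remark after Theorem 2.5), §3.5 Proposition 3.18] -/
theorem tsum_main_col_eq (a : ℤ) (d : ℕ) (R : BinQF) (b : ℤ) (x Y₁ : ℝ) (h : ℤ) (L : ℝ) (m : ℤ)
    (α : ℤ) {μ : ℝ → ℝ} {N : ℤ} (hN : 0 ≤ N) (hμN : ∀ v : ℝ, (N : ℝ) < v → μ v = 0) :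
    ∑' κ, dualTerm a d R b x Y₁ h L m α κ * wMain μ κ =
      posSum a d R b x Y₁ h L m μ α N + conj (posSum a d R b x Y₁ (-h) L m μ α N) := by
  have hsupp : ∀ κ ∉ Finset.Icc (-N) N, dualTerm a d R b x Y₁ h L m α κ * wMain μ κ = 0 := by
    intro κ hκ
    rw [Finset.mem_Icc, not_and_or, not_le, not_le] at hκ
    have hN' : (N : ℝ) < |(κ : ℝ)| := by
      rw [← Int.cast_abs]
      have : N < |κ| := by
        rcases hκ with h1 | h1
        · rw [abs_of_neg (by omega)]; omega
        · rw [abs_of_pos (by omega)]; omega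
      exact_mod_cast this
    unfold wMain
    split_ifs
    · rw [mul_zero]
    · rw [hμN _ hN', Complex.ofReal_zero, mul_zero]
  rw [tsum_eq_sum hsupp, ← Finset.add_sum_erase _ _ (Finset.mem_Icc.2 ⟨by omega, hN⟩)]
  rw [show wMain μ 0 = 0 from if_pos rfl, mul_zero, zero_add, sum_Icc_erase_zero_eq,
    Finset.sum_add_distrib, posSum, posSum, map_sum]
  congr 1
  · refine Finset.sum_congr rfl fun κ hκ => ?_
    rw [Finset.mem_Icc] at hκ
    unfold wMain
    rw [if_neg (by omega), ← Int.cast_abs, abs_of_pos hκ.1]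
  · refine Finset.sum_congr rfl fun κ hκ => ?_
    rw [Finset.mem_Icc] at hκ
    unfold wMain dualTerm
    rw [if_neg (by omega), Int.cast_neg, abs_neg, ← Int.cast_abs, abs_of_pos hκ.1, map_mul,
      Complex.conj_ofReal, ← dualTerm_neg_right, Int.cast_neg]

/-- **Inserting the modulus partition**: for `1 ≤ α`, if the column function of `α` vanishes
unless `c₀√x ≤ α ≤ c₂√x`... precisely: if `colFn(α,·) ≢ 0` forces `2/λ ≤ α ≤ K_J/λ`, then
`G = ∑_{−1≤j≤J−1} G · dyadic j (λα)` for every `G` that vanishes when `colFn(α,·) ≡ 0`. [folklore] -/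
theorem eq_sum_mul_dyadic_scaled {G : ℂ} {α : ℤ} {lam : ℝ} {J : ℤ}
    (hcases : G = 0 ∨ (2 ≤ lam * α ∧ lam * α ≤ dyScale J)) :
    G = ∑ j ∈ Finset.Icc (-1) (J - 1), G * dyadic j (lam * α) := by
  rcases hcases with h0 | ⟨h1, h2⟩
  · rw [h0]; simp
  · rw [← Finset.mul_sum, sum_dyadic_eq_one (by linarith) (by rwa [sub_add_cancel]), mul_one]

/-- **The positive part as a double sum of dyadic pieces**:
`∑_{1≤α≤A} M_α⁻¹ P_α^{[h]}(μ = ∑_ℓ ρ_ℓ) = ∑_ℓ ∑_j piece(j, ℓ)`, provided every `α ∈ [1, A]` with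
`colFn(α,·) ≢ 0` satisfies `2 ≤ λα ≤ K_J`. [cite: Ngo2024, §3.5 Proposition 3.18 (proof: dyadic partitions)] -/
theorem posPart_eq_sum_pieceSum (a : ℤ) (d : ℕ) (R : BinQF) (b : ℤ) (x Y₁ : ℝ) (h : ℤ) (L : ℝ)
    (m : ℤ) (ℓ₁ : ℤ) (lam : ℝ) {J A N : ℤ}
    (hsupp : ∀ α : ℤ, 1 ≤ α → α ≤ A →
      (∀ t : ℝ, colFn R a b x Y₁ h L m α t = 0) ∨ (2 ≤ lam * α ∧ lam * α ≤ dyScale J)) :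
    ∑ α ∈ Finset.Icc 1 A, (((α.natAbs * (a.toNat * d) : ℕ) : ℂ))⁻¹ *
        posSum a d R b x Y₁ h L m (fun v => ∑ ℓ ∈ Finset.Icc (-1) ℓ₁, dyadicR ℓ v) α N =
      ∑ ℓ ∈ Finset.Icc (-1) ℓ₁, ∑ j ∈ Finset.Icc (-1) (J - 1),
        pieceSum a d R b x Y₁ h L m j ℓ lam A N := by
  -- expand `μ` and pull the `ℓ`-sum out
  have h1 : ∀ α : ℤ, (((α.natAbs * (a.toNat * d) : ℕ) : ℂ))⁻¹ *
      posSum a d R b x Y₁ h L m (fun v => ∑ ℓ ∈ Finset.Icc (-1) ℓ₁, dyadicR ℓ v) α N =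
      ∑ ℓ ∈ Finset.Icc (-1) ℓ₁, (((α.natAbs * (a.toNat * d) : ℕ) : ℂ))⁻¹ *
        ∑ κ ∈ Finset.Icc 1 N, dualTerm a d R b x Y₁ h L m α κ * dyadic ℓ κ := by
    intro α
    unfold posSum
    simp only [Complex.ofReal_sum, Finset.mul_sum, dyadic]
    rw [Finset.sum_comm]
  simp_rw [h1]
  rw [Finset.sum_comm]
  refine Finset.sum_congr rfl fun ℓ _ => ?_
  -- insert the modulus partition for each `α`
  have h2 : ∀ α ∈ Finset.Icc 1 A, (((α.natAbs * (a.toNat * d) : ℕ) : ℂ))⁻¹ *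
      ∑ κ ∈ Finset.Icc 1 N, dualTerm a d R b x Y₁ h L m α κ * dyadic ℓ κ =
      ∑ j ∈ Finset.Icc (-1) (J - 1), ((((α.natAbs * (a.toNat * d) : ℕ) : ℂ))⁻¹ *
        ∑ κ ∈ Finset.Icc 1 N, dualTerm a d R b x Y₁ h L m α κ * dyadic ℓ κ) * dyadic j (lam * α) := by
    intro α hα
    rw [Finset.mem_Icc] at hα
    refine eq_sum_mul_dyadic_scaled ((hsupp α hα.1 hα.2).imp (fun hz => ?_) id)
    have : ∀ κ : ℤ, dualTerm a d R b x Y₁ h L m α κ = 0 := by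
      intro κ
      rw [dualTerm, show (fun t => colFn R a b x Y₁ h L m α t) = (0 : ℝ → ℂ) from funext hz,
        fourier_zero_fun, zero_mul]
    simp [this]
  rw [Finset.sum_congr rfl h2, Finset.sum_comm]
  refine Finset.sum_congr rfl fun j _ => ?_
  unfold pieceSum
  refine Finset.sum_congr rfl fun α _ => ?_
  rw [Finset.mul_sum, Finset.sum_mul]
  refine Finset.sum_congr rfl fun κ _ => ?_
  rw [dualTerm]

end decomposition

end RootForms

end Literature.NumberTheory.Sieve

/-!
## Part 3. Tóth's theorem from Pitt's bound (T. Ngo's Theorem 2.5) for the complete column sums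

Topic `Literature/NumberTheory/Sieve`, the last file of the chain
`…TothReduction` (`HP ⇒` Tóth's theorem) ← `…TothColumnSum` (`HD ⇒ HP`, Poisson duality) ←
`…TothDualZero`, `…TothRays` (three parts) and Parts 1–2 above (this descent).  It proves Ngo's Proposition-3.18 bound `HD` for the Poisson-dual Tóth sums from ONE
analytic input of the shape of T. Ngo's Theorem 2.5 (arXiv:2107.13301 §2.2; "essentially due to
Pitt": Kuznetsov's trace formula, the spectral large sieve for `Γ₀(q)` and the treatment of
exceptional eigenvalues, after Deshouillers–Iwaniec) for the explicit complete sums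
`S_α(h, κ) = colExpSum a d R h α κ` of the columns (`…TothColumnSum`; on paper these are the
cusp-pair Kloosterman sums `S_{σ_∞σ_𝔞}(h, κ; c√q'')` of `Γ₀(ad)`, Ngo's Lemmas 2.4 and 3.15):

* `HK` (hypothesis of `dualBound_of_pittBound` / `toth2000_quadraticRoots_primeModuli_of_pittBound`):
  for every smooth `V` supported in `(C, 2C) × (K, 2K)` (`C > 0`, `K ≥ 1/2`, `Y ≥ 1`) with
  `‖∂_uᴵ ∂_κᴶ V‖ ≤ A(I,J) Y^{I+J}/(Cᴵ Kᴶ)`,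
  `‖∑_{1≤κ≤N_κ} ∑_{1≤α≤N_α} S_α(h,κ)/α · V(α,κ)‖ ≤ K_c · pittBoundFn(ad, K, C, Y, (h, ad), ε)`
  with `K_c` depending only on the form, `ε` and the constant family `A`
  [cite: Ngo2024, §2.2 Theorem 2.5];
* `dualBound_of_pittBound` — `HK ⇒ HD` (Ngo's §3.5: the `κ = 0` column, the tail `|κ| > dY₁x^η`,
  dyadic partitions, Theorem 2.5 along each ray `t = us`, and the arithmetic of Proposition 3.18,
  `pittCore_le`, done in exp–log coordinates);
* **`toth2000_quadraticRoots_primeModuli_of_pittBound`** — `HK ⇒ toth2000_quadraticRoots_primeModuli`.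

No named fact is introduced; the trust base of Tóth's theorem along the printed lines is thereby
reduced to `HK`, i.e. to the Kuznetsov/large-sieve theory of sums of Kloosterman sums on `Γ₀(q)`
(absent from Mathlib), applied to the explicit sums `colExpSum`.

## References

* T. Ngo, *On roots of quadratic congruences*, arXiv:2107.13301 (Bull. LMS 2024), §2.2 Theorem 2.5,
  §3.5 Lemmas 3.15–3.17, Proposition 3.18, Corollary 3.19.
  [cite: Ngo2024, §2.2 Theorem 2.5, §3.5 Proposition 3.18]
* Á. Tóth, *Roots of quadratic congruences*, Internat. Math. Res. Notices 2000, no. 14, 719–739.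
  [cite: Toth2000, main theorem, §4]
* N. J. E. Pitt, *On an analogue of Titchmarsh's divisor problem for holomorphic cusp forms*,
  J. Amer. Math. Soc. 26 (2013), 735–776 (the bound for sums of Kloosterman sums). [cite: Ngo2024, §2.2 (reference [Pitt])]
-/

noncomputable section

namespace Literature.NumberTheory.Sieve

open scoped MatrixGroups ContDiff FourierTransform ComplexConjugate
open Literature.NumberTheory.QuadraticFields.Quadratic (BinQF)
open Real Finset MeasureTheory

namespace RootForms

/-! ### Elementary arithmetic of the final bound (exp–log form) -/

/-- Four exponentials against two: `e^{E₁} + e^{E₂} + (e^{E₃} + e^{E₄}) ≤ e^{P₁} + e^{P₂}` when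
`Eᵢ + log 2 ≤ P_{j(i)}`. [folklore] -/
theorem exp_four_le {E₁ E₂ E₃ E₄ P₁ P₂ : ℝ} (h₁ : E₁ + Real.log 2 ≤ P₁) (h₂ : E₂ + Real.log 2 ≤ P₁)
    (h₃ : E₃ + Real.log 2 ≤ P₂) (h₄ : E₄ + Real.log 2 ≤ P₂) :
    Real.exp E₁ + Real.exp E₂ + (Real.exp E₃ + Real.exp E₄) ≤ Real.exp P₁ + Real.exp P₂ := by
  have key : ∀ {E P : ℝ}, E + Real.log 2 ≤ P → Real.exp E ≤ Real.exp P / 2 := by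
    intro E P h
    rw [le_div_iff₀ two_pos, ← Real.exp_log two_pos, ← Real.exp_add]
    exact Real.exp_le_exp.2 h
  have e1 := key h₁; have e2 := key h₂; have e3 := key h₃; have e4 := key h₄
  linarith

/-- **The core of Pitt's bound at Ngo's parameters, exp–log form.**  With `q = a d`,
`K₀ = d Y₁ P`, `C = c x^{1/2}`, `Y = c_Y Y₁ P`, `g ↦ a g` (all atoms written as exponentials of
nonnegative logarithms; `P = x^η`):
`q⁻¹ C · pittCore(q, K₀, C, Y, ag) ≤ 4 (a c c_Y)⁴ (g^{1/4} x^{3/4} d^{-1/2} Y₁^{9/4} + x^{1/2} Y₁³) P³`.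
This is the arithmetic of the last display in the proof of Ngo's Proposition 3.18.
[cite: Ngo2024, §3.5 Proposition 3.18 (proof, (3.21)–(3.22))] -/
theorem pittCore_arith {la lc lcY ld lx lY lG lP : ℝ} (hla : 0 ≤ la) (hlc : 0 ≤ lc)
    (hlcY : 0 ≤ lcY) (hlY : 0 ≤ lY) (hlP : 0 ≤ lP) :
    (Real.exp la * Real.exp ld)⁻¹ * (Real.exp lc * Real.exp lx ^ (1 / 2 : ℝ)) *
      pittCore (Real.exp la * Real.exp ld) (Real.exp ld * Real.exp lY * Real.exp lP)
        (Real.exp lc * Real.exp lx ^ (1 / 2 : ℝ)) (Real.exp lcY * Real.exp lY * Real.exp lP)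
        (Real.exp la * Real.exp lG) ≤
    Real.exp (Real.log 4) * (Real.exp la * Real.exp lc * Real.exp lcY) ^ (4 : ℝ) *
      (Real.exp lG ^ (1 / 4 : ℝ) * Real.exp lx ^ (3 / 4 : ℝ) * Real.exp ld ^ (-(1 / 2) : ℝ) *
          Real.exp lY ^ (9 / 4 : ℝ) + Real.exp lx ^ (1 / 2 : ℝ) * Real.exp lY ^ (3 : ℝ)) *
      Real.exp lP ^ (3 : ℝ) := by
  have hl2 : 0 < Real.log 2 := Real.log_pos one_lt_two
  have hl4 := Real.log_four_eq
  unfold pittCore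
  simp only [mul_add, add_mul, one_mul, ← Real.exp_mul, ← Real.exp_add, ← Real.exp_neg, mul_assoc]
  apply exp_four_le <;> linarith

/-- **The `(qYKC)^ε` factor at Ngo's parameters**: with `q = ad`, `Y = c_Y Y₁ x^η`, `K₀ = d Y₁ x^η`,
`C = c x^{1/2}`, `η ≤ 3/4`, `0 ≤ ε₁ ≤ 1` and `a, c, c_Y, d, x, Y₁ ≥ 1`:
`(q Y K₀ C)^{ε₁} ≤ (a c_Y c) (x d Y₁)^{2ε₁}`. [folklore] -/
theorem epsFactor_le {a c cY d x Y₁ η ε₁ : ℝ} (ha : 1 ≤ a) (hc : 1 ≤ c) (hcY : 1 ≤ cY) (hd : 1 ≤ d)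
    (hx : 1 ≤ x) (hY : 1 ≤ Y₁) (hη : η ≤ 3 / 4) (hε0 : 0 ≤ ε₁) (hε1 : ε₁ ≤ 1) :
    ((a * d) * (cY * Y₁ * x ^ η) * (d * Y₁ * x ^ η) * (c * x ^ (1 / 2 : ℝ))) ^ ε₁ ≤
      (a * cY * c) * (x * d * Y₁) ^ (2 * ε₁) := by
  have hx0 : 0 < x := by linarith
  -- the base is at most `(a c_Y c) (x d Y₁)²`
  have hP : x ^ η * x ^ η * x ^ (1 / 2 : ℝ) ≤ x ^ (2 : ℝ) := by
    rw [← Real.rpow_add hx0, ← Real.rpow_add hx0]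
    exact Real.rpow_le_rpow_of_exponent_le hx (by linarith)
  have hbase : (a * d) * (cY * Y₁ * x ^ η) * (d * Y₁ * x ^ η) * (c * x ^ (1 / 2 : ℝ)) ≤
      (a * cY * c) * (x * d * Y₁) ^ (2 : ℝ) := by
    calc (a * d) * (cY * Y₁ * x ^ η) * (d * Y₁ * x ^ η) * (c * x ^ (1 / 2 : ℝ))
        = (a * cY * c) * (d * Y₁) ^ (2 : ℕ) * (x ^ η * x ^ η * x ^ (1 / 2 : ℝ)) := by ring
      _ ≤ (a * cY * c) * (d * Y₁) ^ (2 : ℕ) * x ^ (2 : ℝ) := by gcongr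
      _ = (a * cY * c) * (x * d * Y₁) ^ (2 : ℝ) := by
          rw [show ((2 : ℝ)) = ((2 : ℕ) : ℝ) by norm_num, Real.rpow_natCast, Real.rpow_natCast]; ring
  have hb0 : 0 ≤ (a * d) * (cY * Y₁ * x ^ η) * (d * Y₁ * x ^ η) * (c * x ^ (1 / 2 : ℝ)) := by positivity
  calc ((a * d) * (cY * Y₁ * x ^ η) * (d * Y₁ * x ^ η) * (c * x ^ (1 / 2 : ℝ))) ^ ε₁
      ≤ ((a * cY * c) * (x * d * Y₁) ^ (2 : ℝ)) ^ ε₁ := Real.rpow_le_rpow hb0 hbase hε0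
    _ = (a * cY * c) ^ ε₁ * (x * d * Y₁) ^ (2 * ε₁) := by
        rw [Real.mul_rpow (by positivity) (by positivity), ← Real.rpow_mul (by positivity)]
    _ ≤ (a * cY * c) * (x * d * Y₁) ^ (2 * ε₁) := by
        have h1 : (1 : ℝ) ≤ a * cY * c := one_le_mul_of_one_le_of_one_le (one_le_mul_of_one_le_of_one_le ha hcY) hc
        have : (a * cY * c) ^ ε₁ ≤ (a * cY * c) ^ (1 : ℝ) := Real.rpow_le_rpow_of_exponent_le h1 hε1
        rw [Real.rpow_one] at this
        exact mul_le_mul_of_nonneg_right this (by positivity)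

/-- **The core of Pitt's bound at Ngo's parameters** (atom form): for `a, c, c_Y, d, x, Y₁, g, P ≥ 1`,
`(ad)⁻¹ (c x^{1/2}) · pittCore(ad, d Y₁ P, c x^{1/2}, c_Y Y₁ P, a g)
  ≤ 4 (a c c_Y)⁴ (g^{1/4} x^{3/4} d^{-1/2} Y₁^{9/4} + x^{1/2} Y₁³) P³`.
[cite: Ngo2024, §3.5 Proposition 3.18 (proof, last display)] -/
theorem pittCore_le {a c cY d x Y₁ g P : ℝ} (ha : 1 ≤ a) (hc : 1 ≤ c) (hcY : 1 ≤ cY) (hd : 1 ≤ d)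
    (hx : 1 ≤ x) (hY : 1 ≤ Y₁) (hg : 1 ≤ g) (hP : 1 ≤ P) :
    (a * d)⁻¹ * (c * x ^ (1 / 2 : ℝ)) *
      pittCore (a * d) (d * Y₁ * P) (c * x ^ (1 / 2 : ℝ)) (cY * Y₁ * P) (a * g) ≤
    4 * (a * c * cY) ^ (4 : ℝ) *
      (g ^ (1 / 4 : ℝ) * x ^ (3 / 4 : ℝ) * d ^ (-(1 / 2) : ℝ) * Y₁ ^ (9 / 4 : ℝ) +
        x ^ (1 / 2 : ℝ) * Y₁ ^ (3 : ℝ)) * P ^ (3 : ℝ) := by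
  have h := pittCore_arith (Real.log_nonneg ha) (Real.log_nonneg hc) (Real.log_nonneg hcY)
    (Real.log_nonneg hY) (Real.log_nonneg hP) (ld := Real.log d) (lx := Real.log x) (lG := Real.log g)
  simp only [Real.exp_log (by linarith : (0 : ℝ) < a), Real.exp_log (by linarith : (0 : ℝ) < c),
    Real.exp_log (by linarith : (0 : ℝ) < cY), Real.exp_log (by linarith : (0 : ℝ) < d),
    Real.exp_log (by linarith : (0 : ℝ) < x), Real.exp_log (by linarith : (0 : ℝ) < Y₁),
    Real.exp_log (by linarith : (0 : ℝ) < g), Real.exp_log (by linarith : (0 : ℝ) < P),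
    Real.exp_log (by norm_num : (0 : ℝ) < 4)] at h
  exact h

/-- A dyadic scale above any real: `∃ J ≥ 0, r ≤ K_J` (`K_{2n} = 2ⁿ`). [folklore] -/
theorem exists_dyScale_ge (r : ℝ) : ∃ J : ℤ, 0 ≤ J ∧ r ≤ dyScale J := by
  obtain ⟨n, hn⟩ := pow_unbounded_of_one_lt r one_lt_two
  refine ⟨2 * n, by positivity, hn.le.trans (le_of_eq ?_)⟩
  unfold dyScale
  rw [show (((2 * (n : ℤ) : ℤ)) : ℝ) / 2 = (n : ℝ) by push_cast; ring, Real.rpow_natCast]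

/-- **The frequency cut-off index** `ℓ₁ = ⌊2 log K₀/log 2⌋` (`K₀ ≥ 1`): `0 ≤ ℓ₁`, `K_{ℓ₁} ≤ K₀`,
`K₀ < K_{ℓ₁+1}` and `ℓ₁ ≤ 3 log K₀`. [folklore] -/
theorem ell_facts {K₀ : ℝ} (hK : 1 ≤ K₀) :
    0 ≤ ⌊2 * Real.log K₀ / Real.log 2⌋ ∧ dyScale ⌊2 * Real.log K₀ / Real.log 2⌋ ≤ K₀ ∧
      K₀ < dyScale (⌊2 * Real.log K₀ / Real.log 2⌋ + 1) ∧
      ((⌊2 * Real.log K₀ / Real.log 2⌋ : ℤ) : ℝ) ≤ 3 * Real.log K₀ := by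
  have hl2 : 0 < Real.log 2 := Real.log_pos one_lt_two
  have hlK : 0 ≤ Real.log K₀ := Real.log_nonneg hK
  have hK0 : 0 < K₀ := by linarith
  set t : ℝ := 2 * Real.log K₀ / Real.log 2 with ht
  have ht0 : 0 ≤ t := by positivity
  have e : t / 2 * Real.log 2 = Real.log K₀ := by rw [ht]; field_simp
  refine ⟨Int.floor_nonneg.2 ht0, ?_, ?_, ?_⟩
  · rw [← Real.log_le_log_iff (dyScale_pos _) hK0, log_dyScale, ← e]
    exact mul_le_mul_of_nonneg_right (div_le_div_of_nonneg_right (Int.floor_le t) zero_le_two) hl2.le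
  · rw [← Real.log_lt_log_iff hK0 (dyScale_pos _), log_dyScale, ← e]
    have h1 : t < ((⌊t⌋ + 1 : ℤ) : ℝ) := by push_cast; exact Int.lt_floor_add_one t
    exact mul_lt_mul_of_pos_right (div_lt_div_of_pos_right h1 two_pos) hl2
  · calc ((⌊t⌋ : ℤ) : ℝ) ≤ t := Int.floor_le t
      _ = (2 / Real.log 2) * Real.log K₀ := by rw [ht]; ring
      _ ≤ 3 * Real.log K₀ := by
          refine mul_le_mul_of_nonneg_right ?_ hlK
          rw [div_le_iff₀ hl2]
          have := Real.log_two_gt_d9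
          linarith

/-- `gcd(h, ad) ≤ a · gcd(h, d)` for `a > 0`, `h ≠ 0` (as reals). [folklore] -/
theorem gcd_mul_le_real {a : ℤ} (ha : 0 < a) {h : ℤ} (hh : h ≠ 0) (d : ℕ) :
    (Int.gcd h (a * d) : ℝ) ≤ (a : ℝ) * (Int.gcd h d : ℝ) := by
  have hn : 0 < h.natAbs := Int.natAbs_pos.2 hh
  have e1 : Int.gcd h (a * d) = Nat.gcd h.natAbs (a.natAbs * d) := by
    rw [Int.gcd_eq_natAbs, Int.natAbs_mul, Int.natAbs_natCast]
  have e2 : Int.gcd h d = Nat.gcd h.natAbs d := by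
    rw [Int.gcd_eq_natAbs, Int.natAbs_natCast]
  have hdvd := Nat.gcd_mul_right_dvd_mul_gcd h.natAbs a.natAbs d
  have hpos : 0 < Nat.gcd h.natAbs a.natAbs * Nat.gcd h.natAbs d :=
    Nat.mul_pos (Nat.gcd_pos_of_pos_left _ hn) (Nat.gcd_pos_of_pos_left _ hn)
  have h1 : Nat.gcd h.natAbs (a.natAbs * d) ≤ a.natAbs * Nat.gcd h.natAbs d :=
    (Nat.le_of_dvd hpos hdvd).trans (Nat.mul_le_mul_right _
      (Nat.gcd_le_right _ (Int.natAbs_pos.2 ha.ne')))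
  have ha' : ((a.natAbs : ℕ) : ℝ) = (a : ℝ) := by
    rw [← Int.cast_natCast, Int.natCast_natAbs, abs_of_pos ha]
  rw [e1, e2, ← ha']
  exact_mod_cast h1

/-! ### The main estimate: Ngo's Proposition 3.18 bound `HD` from Pitt's bound -/

section main

variable {a : ℤ}

set_option maxHeartbeats 1600000 in -- one long assembly (Ngo's §3.5 bookkeeping: ~60 local facts, three dyadic/tail/zero bounds); 8× the default budget
/-- **The dual-sum bound `HD` from Pitt's bound for the complete sums** (for fixed `a, b, c`).
If the sums `∑_{κ≥1} ∑_{α≥1} S_α(h,κ)/α · V(α,κ)` of the complete sums `S_α(h, κ) = colExpSum`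
against smooth weights `V` supported in `(C,2C) × (K,2K)` with `‖∂_uᴵ∂_κᴶ V‖ ≤ A(I,J) Y^{I+J}/(CᴵKᴶ)`
obey the bound of T. Ngo's Theorem 2.5 (Pitt: Kuznetsov's formula and the spectral large sieve on
`Γ₀(ad)`) — hypothesis `HK` — then the Poisson-dual Tóth sums obey Ngo's Proposition-3.18 bound
`HD` of `…TothColumnSum.toth2000_quadraticRoots_primeModuli_of_dualBound`.  The proof is Ngo's
(§3.5): the `κ = 0` column (`exists_dualZero_bound`), truncation of `|κ| > K₀ = dY₁x^η`
(`exists_dualTail_bound`, Lemma 3.16), dyadic partitions of the main part, Theorem 2.5 for each ray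
parameter `s` (Lemma 3.17 = `norm_iteratedDeriv_pieceWeight_le`), and the final arithmetic.
[cite: Ngo2024, §3.5 Proposition 3.18, Lemmas 3.15–3.17, §2.2 Theorem 2.5; Toth2000, §4] -/
theorem dualBound_of_pittBound {b c : ℤ} (ha : 0 < a) (hΔ : 0 < discrim a b c)
    (hsq : ¬ IsSquare (discrim a b c))
    (HK : ∀ R : BinQF, IsLevelForm a b (discrim a b c) a.toNat R → R.a ≠ 0 →
      ∀ ε : ℝ, 0 < ε → ∀ Ac : ℕ → ℕ → ℝ, ∃ Kc : ℝ, 0 ≤ Kc ∧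
        ∀ d : ℕ, 1 ≤ d → ∀ h : ℤ, h ≠ 0 → ∀ C K Y : ℝ, 0 < C → 1 / 2 ≤ K → 1 ≤ Y →
        ∀ V : ℝ → ℝ → ℂ, ContDiff ℝ ∞ (Function.uncurry V) →
          (∀ u κ, V u κ ≠ 0 → C < u ∧ u < 2 * C ∧ K < κ ∧ κ < 2 * K) →
          (∀ (I J : ℕ) (u κ : ℝ),
            ‖iteratedDeriv I (fun u' => iteratedDeriv J (fun κ' => V u' κ') κ) u‖ ≤
              Ac I J * (Y ^ (I + J) / (C ^ I * K ^ J))) →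
        ∀ Nα Nκ : ℤ, ‖pittSum a d R h V Nα Nκ‖ ≤
          Kc * pittBoundFn ((a.toNat * d : ℕ) : ℝ) K C Y (Int.gcd h (a * d)) ε) :
    ∀ R : BinQF, IsLevelForm a b (discrim a b c) a.toNat R → R.a ≠ 0 →
      ∀ g₁ : SL(2, ℤ), g₁ ∈ stabLevel R a.toNat → deckFactor R g₁ < 1 →
        (∀ s ∈ stabLevel R a.toNat, ∃ k : ℤ, s = g₁ ^ k ∨ s = -g₁ ^ k) →
      ∀ ε : ℝ, 0 < ε → ∀ Ch : ℝ, 0 < Ch → ∃ K : ℝ, 0 ≤ K ∧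
        ∀ x Y₁ : ℝ, 2 ≤ Y₁ → Y₁ ≤ x → ∀ d : ℕ, 1 ≤ d → (d : ℝ) ^ 2 ≤ x →
          ∀ h : ℤ, h ≠ 0 → |(h : ℝ)| ≤ Ch * x →
          ∀ A : ℤ, (∀ α γ : ℤ, colFn R a b x Y₁ h (Real.log (deckFactor R g₁)⁻¹) (tothShift R g₁) α γ ≠ 0 →
              |(α : ℝ)| ≤ A ∧ |(γ : ℝ)| ≤ A) →
          ‖∑ α ∈ (Finset.Icc (-A) A).erase 0, (((α.natAbs * (a.toNat * d) : ℕ) : ℂ))⁻¹ *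
              ∑' κ : ℤ, 𝓕 (fun t => colFn R a b x Y₁ h (Real.log (deckFactor R g₁)⁻¹) (tothShift R g₁) α t)
                ((κ : ℝ) / ((α.natAbs * (a.toNat * d) : ℕ) : ℝ)) * colExpSum a d R h α κ‖ ≤
            K * ((Int.gcd h d : ℝ) ^ (1 / 4 : ℝ) * x ^ (3 / 4 : ℝ) * (d : ℝ) ^ (-(1 / 2) : ℝ) *
                  Y₁ ^ (9 / 4 : ℝ) + x ^ (1 / 2 : ℝ) * Y₁ ^ (3 : ℝ)) * (x * d * Y₁) ^ ε := by
  intro R hR hRa g₁ hg₁ hκ _hgen ε hε Ch hCh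
  -- we may work with `ε₀ = min ε 1 ≤ 1` and weaken at the end
  set ε₀ : ℝ := min ε 1 with hε₀def
  have hε₀ : 0 < ε₀ := lt_min hε one_pos
  have hε₀1 : ε₀ ≤ 1 := min_le_right _ _
  have hε₀ε : ε₀ ≤ ε := min_le_left _ _
  -- data of the form
  have hΔR : 0 < R.disc := by rw [hR.disc_eq]; exact hΔ
  have hsqR : ¬ IsSquare R.disc := by rw [hR.disc_eq]; exact hsq
  have hκ0 : 0 < deckFactor R g₁ := deckFactor_pos hRa hΔR.le hg₁.1
  obtain ⟨c₀, hc₀, hlow⟩ := exists_colFn_tothShift_support_lower hRa hΔR hsqR ha hκ0 hκ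
  obtain ⟨KZ, hKZ0, hZ⟩ := exists_dualZero_bound ha hΔ hsq hR hRa hg₁ hκ hε hCh
  have hη : 0 < ε₀ / 8 := by positivity
  obtain ⟨KT, hKT0, hT⟩ := exists_dualTail_bound ha hΔ hsq hR hRa hg₁ hκ hη hCh
  set L : ℝ := Real.log (deckFactor R g₁)⁻¹ with hLdef
  have hL : 0 < L := Real.log_pos ((one_lt_inv₀ hκ0).2 hκ)
  set m : ℤ := tothShift R g₁ with hmdef
  obtain ⟨c₁, c₂, hc₁, hc₁₂, hcs⟩ := exists_colFn_support_consts hRa hΔR ha hL m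
  have hc₂ : 0 < c₂ := hc₁.trans_le hc₁₂
  -- constants
  set S : ℝ := c₂ / c₀ with hSdef
  have hS0 : 0 < S := div_pos hc₂ hc₀
  obtain ⟨J, hJ0, hJ⟩ := exists_dyScale_ge (2 * c₂ / c₀)
  have hJr : (0 : ℝ) ≤ J := by exact_mod_cast hJ0
  set c' : ℝ := max 1 (dyScale J * c₀ / 2) with hc'def
  have hc'1 : 1 ≤ c' := le_max_left _ _
  have hc'0 : 0 < c' := by linarith
  have ha1 : (1 : ℝ) ≤ a := by exact_mod_cast ha
  have ha0 : (0 : ℝ) < a := by linarith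
  set cY : ℝ := 1 + 8 * S / a with hcYdef
  have hcY1 : 1 ≤ cY := by
    have : 0 ≤ 8 * S / a := by positivity
    rw [hcYdef]; linarith
  have hcY0 : 0 < cY := by linarith
  obtain ⟨Kc, hKc0, hKc⟩ := HK R hR hRa (ε₀ / 4) (by positivity)
    (fun I J => fConst R ha b L m hCh.le S I * gConst J)
  set A₄ : ℝ := 3 / (ε₀ / 8) + 2 with hA₄
  have hA₄0 : 0 ≤ A₄ := by positivity
  set KM : ℝ := 32 * A₄ * ((J : ℝ) + 1) * S * Kc * (a * c' * cY) ^ (4 : ℝ) * (a * cY * c') with hKM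
  have hKM0 : 0 ≤ KM := by rw [hKM]; positivity
  refine ⟨KZ + KT + KM, by positivity, ?_⟩
  intro x Y₁ hY hYx d hd hdx h hh hhx A _hsuppA
  have hx1 : 1 ≤ x := by linarith
  have hx0 : 0 < x := by linarith
  have hd1 : (1 : ℝ) ≤ d := by exact_mod_cast hd
  have hd0 : (0 : ℝ) < d := by linarith
  have hY1 : 1 ≤ Y₁ := by linarith
  have hY0 : 0 < Y₁ := by linarith
  have hsx0 : 0 < Real.sqrt x := Real.sqrt_pos.2 hx0
  have hq : ((a.toNat * d : ℕ) : ℝ) = (a : ℝ) * d := by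
    rw [Nat.cast_mul, ← Int.cast_natCast (R := ℝ) a.toNat, Int.toNat_of_nonneg ha.le]
  -- parameters
  set η : ℝ := ε₀ / 8 with hηdef
  set P : ℝ := x ^ η with hPdef
  have hP1 : 1 ≤ P := Real.one_le_rpow hx1 hη.le
  have hP0 : 0 < P := by linarith
  set K₀ : ℝ := (d : ℝ) * Y₁ * P with hK₀def
  have hK₀1 : 1 ≤ K₀ := by
    rw [hK₀def]
    calc (1 : ℝ) = 1 * 1 * 1 := by ring
      _ ≤ (d : ℝ) * Y₁ * P := by gcongr
  have hK₀0 : 0 < K₀ := by linarith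
  set ℓ₁ : ℤ := ⌊2 * Real.log K₀ / Real.log 2⌋ with hℓ₁def
  obtain ⟨hℓ₁0, hℓ₁K, hK₀lt, hℓ₁log⟩ := ell_facts hK₀1
  set Ystar : ℝ := cY * Y₁ * P with hYstar
  have hYY : Y₁ ≤ Ystar := by
    rw [hYstar]
    calc Y₁ = 1 * Y₁ * 1 := by ring
      _ ≤ cY * Y₁ * P := by gcongr
  set lam : ℝ := 2 / (c₀ * Real.sqrt x) with hlamdef
  have hlam : 0 < lam := by positivity
  set Cmax : ℝ := c' * x ^ (1 / 2 : ℝ) with hCmaxdef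
  have hCmax0 : 0 < Cmax := by positivity
  -- the frequency partition `μ = ∑_{−1 ≤ ℓ ≤ ℓ₁} ρ_ℓ`
  set μR : ℝ → ℝ := fun v => ∑ ℓ ∈ Finset.Icc (-1) ℓ₁, dyadicR ℓ v with hμR
  have hμ : ∀ v, 1 ≤ v → 0 ≤ μR v ∧ μR v ≤ 1 := fun v hv => sum_dyadicR_mem hv ℓ₁
  have hμ1 : ∀ v, 1 ≤ v → v ≤ dyScale (ℓ₁ + 1) → μR v = 1 := fun v hv hv' =>
    sum_dyadicR_eq_one hv hv'
  set N : ℤ := ⌈2 * dyScale ℓ₁⌉ with hNdef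
  have hN0 : 0 ≤ N := Int.ceil_nonneg (by have := dyScale_pos ℓ₁; positivity)
  have hμN : ∀ v : ℝ, (N : ℝ) < v → μR v = 0 := by
    intro v hv
    have h2 : 2 * dyScale ℓ₁ ≤ v := (Int.le_ceil _).trans hv.le
    refine Finset.sum_eq_zero fun ℓ hℓ => ?_
    rw [Finset.mem_Icc] at hℓ
    exact dyadicR_eq_zero_of_not fun hh' => by
      have := dyScale_mono hℓ.2; linarith [hh'.2]
  have hK₀tail : ∀ κ : ℤ, wTail μR κ ≠ 0 → K₀ < |(κ : ℝ)| := by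
    intro κ hw
    unfold wTail at hw
    split_ifs at hw with h0
    · exact absurd rfl hw
    · have h1 : (1 : ℝ) ≤ |(κ : ℝ)| := by
        rw [← Int.cast_abs]; exact_mod_cast Int.one_le_abs h0
      by_contra hle
      push Not at hle
      have h2 : μR |(κ : ℝ)| = 1 := hμ1 _ h1 (hle.trans hK₀lt.le)
      apply hw
      rw [h2, sub_self, Complex.ofReal_zero]
  -- summability of the columns
  have hsum : ∀ α : ℤ, α ≠ 0 → Summable fun κ => ‖dualTerm a d R b x Y₁ h L m α κ‖ :=
    fun α hα => (summable_norm_fourier_colFn_mul hRa hΔR ha b hx0 hY h hL m hα hd).congr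
      fun κ => (norm_mul _ _).symm
  -- support facts (for `±h`)
  have hSupp : ∀ h' : ℤ, ∀ u t : ℝ, colFn R a b x Y₁ h' L m u t ≠ 0 → |t| ≤ S * |u| := by
    intro h' u t hne
    have h1 := (hcs b x Y₁ h' u t hx0 hY hne).2.2.1
    have h2 := hlow b x Y₁ h' u t hx0 hY hne
    calc |t| ≤ c₂ * Real.sqrt x := h1
      _ = S * (c₀ * Real.sqrt x) := by rw [hSdef]; field_simp
      _ ≤ S * |u| := mul_le_mul_of_nonneg_left h2 hS0.le
  have hsupp' : ∀ h' : ℤ, ∀ α : ℤ, 1 ≤ α → α ≤ A →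
      (∀ t : ℝ, colFn R a b x Y₁ h' L m α t = 0) ∨ (2 ≤ lam * α ∧ lam * α ≤ dyScale J) := by
    intro h' α hα1 _
    by_cases hex : ∃ t, colFn R a b x Y₁ h' L m α t ≠ 0
    · right
      obtain ⟨t, ht⟩ := hex
      have hαr : (0 : ℝ) < α := by exact_mod_cast (by omega : (0 : ℤ) < α)
      have h1 : c₀ * Real.sqrt x ≤ (α : ℝ) := by
        have := hlow b x Y₁ h' α t hx0 hY ht; rwa [abs_of_pos hαr] at this
      have h2 : (α : ℝ) ≤ c₂ * Real.sqrt x := by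
        have := (hcs b x Y₁ h' α t hx0 hY ht).2.2.2; rwa [abs_of_pos hαr] at this
      have hcs0 : 0 < c₀ * Real.sqrt x := by positivity
      constructor
      · rw [hlamdef, div_mul_eq_mul_div, le_div_iff₀ hcs0]; linarith
      · rw [hlamdef, div_mul_eq_mul_div, div_le_iff₀ hcs0]
        calc 2 * (α : ℝ) ≤ 2 * (c₂ * Real.sqrt x) := by linarith
          _ = (2 * c₂ / c₀) * (c₀ * Real.sqrt x) := by field_simp
          _ ≤ dyScale J * (c₀ * Real.sqrt x) := mul_le_mul_of_nonneg_right hJ hcs0.le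
    · left; push Not at hex; exact hex
  -- the Theorem-2.5 bound for `±h`
  have hKc' : ∀ h' : ℤ, h' ≠ 0 → ∀ C K Y' : ℝ, 0 < C → 1 / 2 ≤ K → 1 ≤ Y' → ∀ V : ℝ → ℝ → ℂ,
      ContDiff ℝ ∞ (Function.uncurry V) →
      (∀ u κ, V u κ ≠ 0 → C < u ∧ u < 2 * C ∧ K < κ ∧ κ < 2 * K) →
      (∀ (I J : ℕ) (u κ : ℝ), ‖iteratedDeriv I (fun u' => iteratedDeriv J (fun κ' => V u' κ') κ) u‖ ≤
        fConst R ha b L m hCh.le S I * gConst J * (Y' ^ (I + J) / (C ^ I * K ^ J))) →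
      ∀ Nα Nκ : ℤ, ‖pittSum a d R h' V Nα Nκ‖ ≤
        Kc * pittBoundFn ((a.toNat * d : ℕ) : ℝ) K C Y' (Int.gcd h' (a * d)) (ε₀ / 4) :=
    fun h' hh'0 => hKc d hd h' hh'0
  -- the uniform piece bound
  set G : ℝ := (Int.gcd h d : ℝ) with hGdef
  have hG1 : 1 ≤ G := by rw [hGdef]; exact_mod_cast Int.gcd_pos_of_ne_zero_left _ hh
  have hG0 : 0 < G := by linarith
  set Bmax : ℝ := ((a : ℝ) * d)⁻¹ * Cmax * (2 * S * (Kc * pittBoundFn ((a : ℝ) * d) K₀ Cmax Ystar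
    (a * G) (ε₀ / 4))) with hBmax
  have hpiece : ∀ h' : ℤ, (h' = h ∨ h' = -h) → ∀ ℓ ∈ Finset.Icc (-1) ℓ₁, ∀ j ∈ Finset.Icc (-1) (J - 1),
      ‖pieceSum a d R b x Y₁ h' L m j ℓ lam A N‖ ≤ Bmax := by
    intro h' hh' ℓ hℓ j hj
    rw [Finset.mem_Icc] at hℓ hj
    have hh'0 : h' ≠ 0 := by
      rcases hh' with rfl | rfl
      · exact hh
      · exact neg_ne_zero.2 hh
    have hh'x : |(h' : ℝ)| ≤ Ch * x := by
      rcases hh' with rfl | rfl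
      · exact hhx
      · push_cast; rw [abs_neg]; exact hhx
    have hgcd : (Int.gcd h' (a * d) : ℝ) ≤ a * G := by
      rcases hh' with rfl | rfl
      · exact gcd_mul_le_real ha hh d
      · rw [Int.neg_gcd]; exact gcd_mul_le_real ha hh d
    have hKℓ : dyScale ℓ ≤ K₀ := (dyScale_mono hℓ.2).trans hℓ₁K
    have hcY' : 2 * Real.pi * (S / ((a.toNat * d : ℕ) : ℝ)) * dyScale ℓ ≤ Ystar := by
      rw [hq, hYstar]
      have hpi : Real.pi ≤ 4 := Real.pi_le_four
      have hYP : 0 ≤ Y₁ * P := by positivity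
      calc 2 * Real.pi * (S / (a * d)) * dyScale ℓ ≤ 2 * Real.pi * (S / (a * d)) * K₀ := by
            have : 0 ≤ 2 * Real.pi * (S / (a * d)) := by positivity
            exact mul_le_mul_of_nonneg_left hKℓ this
        _ = (2 * Real.pi) * (S / a) * (Y₁ * P) := by
            rw [hK₀def, div_mul_eq_div_div]
            field_simp
        _ ≤ 8 * (S / a) * (Y₁ * P) := by
            have h8 : 2 * Real.pi ≤ 8 := by linarith
            exact mul_le_mul_of_nonneg_right (mul_le_mul_of_nonneg_right h8 (by positivity)) hYP
        _ ≤ 8 * (S / a) * (Y₁ * P) + 1 * (Y₁ * P) := le_add_of_nonneg_right (by positivity)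
        _ = (1 + 8 * S / a) * Y₁ * P := by ring
    have h1 := norm_pieceSum_le hRa hΔR ha b L m hCh.le hS0.le hd hx0 hY hh'x hL (hSupp h') j hℓ.1
      hlam hYY hcY' hKc0 (hKc' h' hh'0) A N
    refine h1.trans ?_
    rw [hq, hBmax]
    have hCj : dyScale j / lam ≤ Cmax := by
      rw [hlamdef, div_div_eq_mul_div, hCmaxdef, ← Real.sqrt_eq_rpow]
      calc dyScale j * (c₀ * Real.sqrt x) / 2 ≤ dyScale J * (c₀ * Real.sqrt x) / 2 := by
            have := dyScale_mono (show j ≤ J by omega)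
            gcongr
        _ = (dyScale J * c₀ / 2) * Real.sqrt x := by ring
        _ ≤ c' * Real.sqrt x := mul_le_mul_of_nonneg_right (le_max_right _ _) hsx0.le
    have hCj0 : 0 < dyScale j / lam := div_pos (dyScale_pos j) hlam
    have hmono := pittBoundFn_mono (q := (a : ℝ) * d) (ε := ε₀ / 4) (Y := Ystar) (by positivity)
      (by positivity) (dyScale_pos ℓ).le hKℓ hCj0.le hCj (by positivity) (Nat.cast_nonneg _) hgcd
    have hinv : 0 ≤ ((a : ℝ) * d)⁻¹ := by positivity
    have hB0' : 0 ≤ 2 * S * (Kc * pittBoundFn ((a : ℝ) * d) (dyScale ℓ) (dyScale j / lam) Ystar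
        (Int.gcd h' (a * d)) (ε₀ / 4)) :=
      mul_nonneg (mul_nonneg zero_le_two hS0.le) (mul_nonneg hKc0 (pittBoundFn_nonneg (by positivity)
        (dyScale_pos ℓ).le hCj0.le (by positivity) (Nat.cast_nonneg _) _))
    exact mul_le_mul (mul_le_mul_of_nonneg_left hCj hinv)
      (mul_le_mul_of_nonneg_left (mul_le_mul_of_nonneg_left hmono hKc0) (by positivity))
      hB0' (by positivity)
  -- Step 1: the decomposition `Z + Mn + Tl`
  show ‖∑ α ∈ (Finset.Icc (-A) A).erase 0, (((α.natAbs * (a.toNat * d) : ℕ) : ℂ))⁻¹ *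
      ∑' κ : ℤ, dualTerm a d R b x Y₁ h L m α κ‖ ≤ _
  set E : Finset ℤ := (Finset.Icc (-A) A).erase 0 with hE
  have hsplit : ∑ α ∈ E, (((α.natAbs * (a.toNat * d) : ℕ) : ℂ))⁻¹ *
        ∑' κ : ℤ, dualTerm a d R b x Y₁ h L m α κ =
      ∑ α ∈ E, (((α.natAbs * (a.toNat * d) : ℕ) : ℂ))⁻¹ * dualTerm a d R b x Y₁ h L m α 0 +
      ∑ α ∈ E, (((α.natAbs * (a.toNat * d) : ℕ) : ℂ))⁻¹ *
        ∑' κ : ℤ, dualTerm a d R b x Y₁ h L m α κ * wMain μR κ +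
      ∑ α ∈ E, (((α.natAbs * (a.toNat * d) : ℕ) : ℂ))⁻¹ *
        ∑' κ : ℤ, dualTerm a d R b x Y₁ h L m α κ * wTail μR κ := by
    rw [← Finset.sum_add_distrib, ← Finset.sum_add_distrib]
    refine Finset.sum_congr rfl fun α hα => ?_
    rw [tsum_split (hsum α (Finset.ne_of_mem_erase hα)) hμ]; ring
  rw [hsplit]
  -- Step 2: the `κ = 0` column
  have hZb : ‖∑ α ∈ E, (((α.natAbs * (a.toNat * d) : ℕ) : ℂ))⁻¹ * dualTerm a d R b x Y₁ h L m α 0‖ ≤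
      KZ * x ^ (3 / 4 : ℝ) * (d : ℝ) ^ (-(1 / 2) : ℝ) * (x * d) ^ ε := by
    have h1 := hZ x Y₁ hY hYx d hd h hh hhx A
    refine le_of_eq_of_le ?_ h1
    congr 1
    refine Finset.sum_congr rfl fun α _ => ?_
    rw [dualTerm, Int.cast_zero, zero_div]
  -- Step 3: the tail
  have hTb : ‖∑ α ∈ E, (((α.natAbs * (a.toNat * d) : ℕ) : ℂ))⁻¹ *
      ∑' κ : ℤ, dualTerm a d R b x Y₁ h L m α κ * wTail μR κ‖ ≤ KT := by
    refine (norm_sum_le _ _).trans ?_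
    refine le_trans (Finset.sum_le_sum fun α hα => norm_tail_col_le a d R b x Y₁ h L m α
      (hsum α (Finset.ne_of_mem_erase hα)) hμ hK₀tail) ?_
    exact hT x Y₁ hY hYx d hd hdx h hh hhx A K₀ le_rfl
  -- Step 4: the main part
  have hMn : ∑ α ∈ E, (((α.natAbs * (a.toNat * d) : ℕ) : ℂ))⁻¹ *
        ∑' κ : ℤ, dualTerm a d R b x Y₁ h L m α κ * wMain μR κ =
      2 * ∑ α ∈ Finset.Icc 1 A, (((α.natAbs * (a.toNat * d) : ℕ) : ℂ))⁻¹ *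
        (posSum a d R b x Y₁ h L m μR α N + conj (posSum a d R b x Y₁ (-h) L m μR α N)) := by
    have h1 : ∑ α ∈ E, (((α.natAbs * (a.toNat * d) : ℕ) : ℂ))⁻¹ *
          ∑' κ : ℤ, dualTerm a d R b x Y₁ h L m α κ * wMain μR κ =
        ∑ α ∈ E, dualCol a d R b x Y₁ h L m (wMain μR) α := rfl
    rw [h1, hE, sum_dualCol_eq_two_mul ha d R b x Y₁ h L m (wMain_neg μR) A]
    congr 1
    refine Finset.sum_congr rfl fun α _ => ?_
    unfold dualCol
    congr 1
    exact tsum_main_col_eq a d R b x Y₁ h L m α hN0 hμN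
  have hPb : ∀ h' : ℤ, (h' = h ∨ h' = -h) →
      ‖∑ α ∈ Finset.Icc 1 A, (((α.natAbs * (a.toNat * d) : ℕ) : ℂ))⁻¹ *
          posSum a d R b x Y₁ h' L m μR α N‖ ≤ ((ℓ₁ : ℝ) + 2) * ((J : ℝ) + 1) * Bmax := by
    intro h' hh'
    rw [posPart_eq_sum_pieceSum a d R b x Y₁ h' L m ℓ₁ lam (hsupp' h')]
    refine (norm_sum_le _ _).trans ?_
    refine (Finset.sum_le_sum fun ℓ hℓ => (norm_sum_le _ _).trans
      (Finset.sum_le_sum fun j hj => hpiece h' hh' ℓ hℓ j hj)).trans ?_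
    rw [Finset.sum_const, Finset.sum_const, nsmul_eq_mul, nsmul_eq_mul, Int.card_Icc, Int.card_Icc]
    have e1 : (((ℓ₁ + 1 - (-1)).toNat : ℕ) : ℝ) = (ℓ₁ : ℝ) + 2 := by
      have h0 : (0 : ℤ) ≤ ℓ₁ + 1 - (-1) := by omega
      rw [← Int.cast_natCast, Int.toNat_of_nonneg h0]; push_cast; ring
    have e2 : (((J - 1 + 1 - (-1)).toNat : ℕ) : ℝ) = (J : ℝ) + 1 := by
      have h0 : (0 : ℤ) ≤ J - 1 + 1 - (-1) := by omega
      rw [← Int.cast_natCast, Int.toNat_of_nonneg h0]; push_cast; ring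
    rw [e1, e2]
    exact le_of_eq (by ring)
  have hMnb : ‖∑ α ∈ E, (((α.natAbs * (a.toNat * d) : ℕ) : ℂ))⁻¹ *
        ∑' κ : ℤ, dualTerm a d R b x Y₁ h L m α κ * wMain μR κ‖ ≤
      4 * (((ℓ₁ : ℝ) + 2) * ((J : ℝ) + 1) * Bmax) := by
    rw [hMn, norm_mul, Complex.norm_ofNat]
    have hsplit2 : ∑ α ∈ Finset.Icc 1 A, (((α.natAbs * (a.toNat * d) : ℕ) : ℂ))⁻¹ *
        (posSum a d R b x Y₁ h L m μR α N + conj (posSum a d R b x Y₁ (-h) L m μR α N)) =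
        ∑ α ∈ Finset.Icc 1 A, (((α.natAbs * (a.toNat * d) : ℕ) : ℂ))⁻¹ * posSum a d R b x Y₁ h L m μR α N +
        conj (∑ α ∈ Finset.Icc 1 A, (((α.natAbs * (a.toNat * d) : ℕ) : ℂ))⁻¹ *
          posSum a d R b x Y₁ (-h) L m μR α N) := by
      rw [map_sum, ← Finset.sum_add_distrib]
      refine Finset.sum_congr rfl fun α _ => ?_
      rw [mul_add, map_mul, map_inv₀, Complex.conj_natCast]
    rw [hsplit2]
    calc 2 * ‖∑ α ∈ Finset.Icc 1 A, (((α.natAbs * (a.toNat * d) : ℕ) : ℂ))⁻¹ * posSum a d R b x Y₁ h L m μR α N +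
          conj (∑ α ∈ Finset.Icc 1 A, (((α.natAbs * (a.toNat * d) : ℕ) : ℂ))⁻¹ *
            posSum a d R b x Y₁ (-h) L m μR α N)‖
        ≤ 2 * (((ℓ₁ : ℝ) + 2) * ((J : ℝ) + 1) * Bmax + ((ℓ₁ : ℝ) + 2) * ((J : ℝ) + 1) * Bmax) := by
          refine mul_le_mul_of_nonneg_left ((norm_add_le _ _).trans (add_le_add (hPb h (Or.inl rfl)) ?_))
            zero_le_two
          rw [Complex.norm_conj]
          exact hPb (-h) (Or.inr rfl)
      _ = 4 * (((ℓ₁ : ℝ) + 2) * ((J : ℝ) + 1) * Bmax) := by ring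
  -- Step 5: the arithmetic of the constants
  set Sum' : ℝ := G ^ (1 / 4 : ℝ) * x ^ (3 / 4 : ℝ) * (d : ℝ) ^ (-(1 / 2) : ℝ) * Y₁ ^ (9 / 4 : ℝ) +
    x ^ (1 / 2 : ℝ) * Y₁ ^ (3 : ℝ) with hSum'
  set W : ℝ := (x * d * Y₁) ^ ε with hW
  have hxdY1 : 1 ≤ x * d * Y₁ := by
    calc (1 : ℝ) = 1 * 1 * 1 := by ring
      _ ≤ x * d * Y₁ := by gcongr
  have hxdY0 : 0 < x * d * Y₁ := by positivity
  have hW1 : 1 ≤ W := Real.one_le_rpow hxdY1 hε.le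
  have hSum1 : 1 ≤ Sum' := by
    rw [hSum']
    have h1 : 0 ≤ G ^ (1 / 4 : ℝ) * x ^ (3 / 4 : ℝ) * (d : ℝ) ^ (-(1 / 2) : ℝ) * Y₁ ^ (9 / 4 : ℝ) := by
      positivity
    have h2 : 1 ≤ x ^ (1 / 2 : ℝ) * Y₁ ^ (3 : ℝ) :=
      one_le_mul_of_one_le_of_one_le (Real.one_le_rpow hx1 (by norm_num)) (Real.one_le_rpow hY1 (by norm_num))
    linarith
  have hSum0 : 0 < Sum' := by linarith
  -- (i) the `κ = 0` column
  have hZfin : KZ * x ^ (3 / 4 : ℝ) * (d : ℝ) ^ (-(1 / 2) : ℝ) * (x * d) ^ ε ≤ KZ * (Sum' * W) := by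
    have h1 : x ^ (3 / 4 : ℝ) * (d : ℝ) ^ (-(1 / 2) : ℝ) ≤ Sum' := by
      rw [hSum']
      have h2 : x ^ (3 / 4 : ℝ) * (d : ℝ) ^ (-(1 / 2) : ℝ) ≤
          G ^ (1 / 4 : ℝ) * x ^ (3 / 4 : ℝ) * (d : ℝ) ^ (-(1 / 2) : ℝ) * Y₁ ^ (9 / 4 : ℝ) := by
        calc x ^ (3 / 4 : ℝ) * (d : ℝ) ^ (-(1 / 2) : ℝ)
            = 1 * x ^ (3 / 4 : ℝ) * (d : ℝ) ^ (-(1 / 2) : ℝ) * 1 := by ring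
          _ ≤ G ^ (1 / 4 : ℝ) * x ^ (3 / 4 : ℝ) * (d : ℝ) ^ (-(1 / 2) : ℝ) * Y₁ ^ (9 / 4 : ℝ) := by
              gcongr
              · exact Real.one_le_rpow hG1 (by norm_num)
              · exact Real.one_le_rpow hY1 (by norm_num)
      have h3 : 0 ≤ x ^ (1 / 2 : ℝ) * Y₁ ^ (3 : ℝ) := by positivity
      linarith
    have h2 : (x * d) ^ ε ≤ W := by
      rw [hW]
      exact Real.rpow_le_rpow (by positivity) (by nlinarith) hε.le
    calc KZ * x ^ (3 / 4 : ℝ) * (d : ℝ) ^ (-(1 / 2) : ℝ) * (x * d) ^ ε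
        = KZ * ((x ^ (3 / 4 : ℝ) * (d : ℝ) ^ (-(1 / 2) : ℝ)) * (x * d) ^ ε) := by ring
      _ ≤ KZ * (Sum' * W) := by
          refine mul_le_mul_of_nonneg_left (mul_le_mul h1 h2 (by positivity) hSum0.le) hKZ0
  -- (ii) the tail
  have hTfin : KT ≤ KT * (Sum' * W) :=
    le_mul_of_one_le_right hKT0 (one_le_mul_of_one_le_of_one_le hSum1 hW1)
  -- (iii) the main part
  have hlogK : Real.log K₀ ≤ Real.log (x * d * Y₁) := by
    rw [Real.log_le_log_iff hK₀0 hxdY0, hK₀def]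
    have hPx : P ≤ x := by
      rw [hPdef]
      calc x ^ η ≤ x ^ (1 : ℝ) := Real.rpow_le_rpow_of_exponent_le hx1 (by rw [hηdef]; linarith [hε₀1])
        _ = x := Real.rpow_one x
    calc (d : ℝ) * Y₁ * P ≤ (d : ℝ) * Y₁ * x := by gcongr
      _ = x * d * Y₁ := by ring
  have hcount : (ℓ₁ : ℝ) + 2 ≤ A₄ * (x * d * Y₁) ^ (ε₀ / 8) := by
    have h1 : Real.log (x * d * Y₁) ≤ (x * d * Y₁) ^ (ε₀ / 8) / (ε₀ / 8) :=
      Real.log_le_rpow_div hxdY0.le hη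
    have h2 : 1 ≤ (x * d * Y₁) ^ (ε₀ / 8) := Real.one_le_rpow hxdY1 hη.le
    rw [hA₄]
    have h3 : (ℓ₁ : ℝ) ≤ 3 * ((x * d * Y₁) ^ (ε₀ / 8) / (ε₀ / 8)) := hℓ₁log.trans (by linarith)
    calc (ℓ₁ : ℝ) + 2 ≤ 3 * ((x * d * Y₁) ^ (ε₀ / 8) / (ε₀ / 8)) + 2 * (x * d * Y₁) ^ (ε₀ / 8) := by linarith
      _ = (3 / (ε₀ / 8) + 2) * (x * d * Y₁) ^ (ε₀ / 8) := by ring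
  have hcore : ((a : ℝ) * d)⁻¹ * Cmax * pittCore ((a : ℝ) * d) K₀ Cmax Ystar (a * G) ≤
      4 * (a * c' * cY) ^ (4 : ℝ) * Sum' * P ^ (3 : ℝ) :=
    pittCore_le ha1 hc'1 hcY1 hd1 hx1 hY1 hG1 hP1
  have heps : ((a : ℝ) * d * Ystar * K₀ * Cmax) ^ (ε₀ / 4) ≤ (a * cY * c') * (x * d * Y₁) ^ (2 * (ε₀ / 4)) := by
    have h1 := epsFactor_le (η := η) (ε₁ := ε₀ / 4) ha1 hc'1 hcY1 hd1 hx1 hY1 (by rw [hηdef]; linarith [hε₀1])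
      (by positivity) (by linarith [hε₀1])
    refine le_of_eq_of_le ?_ h1
    rw [hYstar, hK₀def, hCmaxdef, hPdef]
  have hPW : P ^ (3 : ℝ) * ((x * d * Y₁) ^ (2 * (ε₀ / 4)) * (x * d * Y₁) ^ (ε₀ / 8)) ≤ W := by
    have h1 : P ^ (3 : ℝ) ≤ (x * d * Y₁) ^ (3 * η) := by
      rw [hPdef, ← Real.rpow_mul hx0.le, mul_comm η 3]
      refine Real.rpow_le_rpow (by positivity) ?_ (by positivity)
      calc x = x * 1 * 1 := by ring
        _ ≤ x * d * Y₁ := by gcongr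
    calc P ^ (3 : ℝ) * ((x * d * Y₁) ^ (2 * (ε₀ / 4)) * (x * d * Y₁) ^ (ε₀ / 8))
        ≤ (x * d * Y₁) ^ (3 * η) * ((x * d * Y₁) ^ (2 * (ε₀ / 4)) * (x * d * Y₁) ^ (ε₀ / 8)) :=
          mul_le_mul_of_nonneg_right h1 (by positivity)
      _ = (x * d * Y₁) ^ ε₀ := by
          rw [← Real.rpow_add hxdY0, ← Real.rpow_add hxdY0, hηdef]
          congr 1; ring
      _ ≤ W := by rw [hW]; exact Real.rpow_le_rpow_of_exponent_le hxdY1 hε₀ε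
  have hMfin : 4 * (((ℓ₁ : ℝ) + 2) * ((J : ℝ) + 1) * Bmax) ≤ KM * (Sum' * W) := by
    -- `Bmax = 2 S Kc · [(ad)⁻¹ Cmax pittCore] · [eps factor]`
    have hB : Bmax = 2 * S * Kc * ((((a : ℝ) * d)⁻¹ * Cmax * pittCore ((a : ℝ) * d) K₀ Cmax Ystar (a * G)) *
        ((a : ℝ) * d * Ystar * K₀ * Cmax) ^ (ε₀ / 4)) := by
      rw [hBmax, pittBoundFn]; ring
    have hB' : Bmax ≤ 2 * S * Kc * ((4 * (a * c' * cY) ^ (4 : ℝ) * Sum' * P ^ (3 : ℝ)) *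
        ((a * cY * c') * (x * d * Y₁) ^ (2 * (ε₀ / 4)))) := by
      rw [hB]
      refine mul_le_mul_of_nonneg_left (mul_le_mul hcore heps (by positivity)
        (mul_nonneg (mul_nonneg (by positivity) hSum0.le) (by positivity))) (by positivity)
    have hJ1 : 0 ≤ (J : ℝ) + 1 := by linarith
    have hB0 : 0 ≤ Bmax := by
      rw [hBmax]
      exact mul_nonneg (by positivity) (mul_nonneg (by positivity) (mul_nonneg hKc0
        (pittBoundFn_nonneg (by positivity) hK₀0.le hCmax0.le (by positivity) (by positivity) _)))
    calc 4 * (((ℓ₁ : ℝ) + 2) * ((J : ℝ) + 1) * Bmax)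
        ≤ 4 * ((A₄ * (x * d * Y₁) ^ (ε₀ / 8)) * ((J : ℝ) + 1) * (2 * S * Kc *
            ((4 * (a * c' * cY) ^ (4 : ℝ) * Sum' * P ^ (3 : ℝ)) *
              ((a * cY * c') * (x * d * Y₁) ^ (2 * (ε₀ / 4)))))) :=
          mul_le_mul_of_nonneg_left (mul_le_mul (mul_le_mul_of_nonneg_right hcount hJ1) hB' hB0
            (by positivity)) (by norm_num)
      _ = KM * Sum' * (P ^ (3 : ℝ) * ((x * d * Y₁) ^ (2 * (ε₀ / 4)) * (x * d * Y₁) ^ (ε₀ / 8))) := by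
          rw [hKM]; ring
      _ ≤ KM * Sum' * W := mul_le_mul_of_nonneg_left hPW (by positivity)
      _ = KM * (Sum' * W) := by ring
  -- conclusion
  calc ‖∑ α ∈ E, (((α.natAbs * (a.toNat * d) : ℕ) : ℂ))⁻¹ * dualTerm a d R b x Y₁ h L m α 0 +
        ∑ α ∈ E, (((α.natAbs * (a.toNat * d) : ℕ) : ℂ))⁻¹ *
          ∑' κ : ℤ, dualTerm a d R b x Y₁ h L m α κ * wMain μR κ +
        ∑ α ∈ E, (((α.natAbs * (a.toNat * d) : ℕ) : ℂ))⁻¹ *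
          ∑' κ : ℤ, dualTerm a d R b x Y₁ h L m α κ * wTail μR κ‖
      ≤ KZ * x ^ (3 / 4 : ℝ) * (d : ℝ) ^ (-(1 / 2) : ℝ) * (x * d) ^ ε +
          4 * (((ℓ₁ : ℝ) + 2) * ((J : ℝ) + 1) * Bmax) + KT :=
        (norm_add₃_le).trans (add_le_add (add_le_add hZb hMnb) hTb)
    _ ≤ KZ * (Sum' * W) + KM * (Sum' * W) + KT * (Sum' * W) := by linarith
    _ = (KZ + KT + KM) * Sum' * W := by ring

/-- **Tóth's theorem from Pitt's bound for the complete column sums.**  If for every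
`f = ax² + bx + c` (`a > 0`, `Δ = b² − 4ac > 0` non-square), every level form `R` of `f`, every
`ε > 0` and every constant family `A(I, J)` the sums `∑_{κ≥1} ∑_{α≥1} S_α(h,κ)/α · V(α,κ)` of the
complete sums `S_α(h,κ) = colExpSum a d R h α κ` against smooth weights `V` supported in
`(C, 2C) × (K, 2K)` with `‖∂_uᴵ∂_κᴶ V‖ ≤ A(I,J) Y^{I+J}/(CᴵKᴶ)` satisfy the bound of T. Ngo's
Theorem 2.5 (Pitt; Kuznetsov's formula and the spectral large sieve on `Γ₀(ad)`), uniformly in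
`d ≥ 1`, `h ≠ 0`, `C > 0`, `K ≥ 1/2`, `Y ≥ 1`, then Tóth's theorem
`toth2000_quadraticRoots_primeModuli` holds.  Everything else — the Duke–Friedlander–Iwaniec sieve
and reductions, Tóth's partition of unity and unfolding, Hooley's identity, Poisson summation, the
`κ = 0` column, the truncation, the dyadic decomposition and the verification of the hypotheses of
Theorem 2.5 — is proved in the tree.
[cite: Toth2000, main theorem; Ngo2024, §2.2 Theorem 2.5, §3.5 Proposition 3.18, Corollary 3.19] -/
theorem toth2000_quadraticRoots_primeModuli_of_pittBound
    (HK : ∀ a b c : ℤ, 0 < a → 0 < discrim a b c → ¬ IsSquare (discrim a b c) →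
      ∀ R : BinQF, IsLevelForm a b (discrim a b c) a.toNat R → R.a ≠ 0 →
      ∀ ε : ℝ, 0 < ε → ∀ Ac : ℕ → ℕ → ℝ, ∃ Kc : ℝ, 0 ≤ Kc ∧
        ∀ d : ℕ, 1 ≤ d → ∀ h : ℤ, h ≠ 0 → ∀ C K Y : ℝ, 0 < C → 1 / 2 ≤ K → 1 ≤ Y →
        ∀ V : ℝ → ℝ → ℂ, ContDiff ℝ ∞ (Function.uncurry V) →
          (∀ u κ, V u κ ≠ 0 → C < u ∧ u < 2 * C ∧ K < κ ∧ κ < 2 * K) →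
          (∀ (I J : ℕ) (u κ : ℝ),
            ‖iteratedDeriv I (fun u' => iteratedDeriv J (fun κ' => V u' κ') κ) u‖ ≤
              Ac I J * (Y ^ (I + J) / (C ^ I * K ^ J))) →
        ∀ Nα Nκ : ℤ, ‖pittSum a d R h V Nα Nκ‖ ≤
          Kc * pittBoundFn ((a.toNat * d : ℕ) : ℝ) K C Y (Int.gcd h (a * d)) ε) :
    toth2000_quadraticRoots_primeModuli :=
  toth2000_quadraticRoots_primeModuli_of_dualBound fun a b c ha hΔ hsq =>
    dualBound_of_pittBound ha hΔ hsq (HK a b c ha hΔ hsq)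

end main

end RootForms

end Literature.NumberTheory.Sieve
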